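import Literature.NumberTheory.LFunctions.Zhang2022.DHCertificate
import Literature.NumberTheory.LFunctions.Zhang2022.DHMenuConsistentCensus
import Literature.NumberTheory.LFunctions.Zhang2022.DHMenuConsistentInformalLOne

/-!
# Zhang (2022), rung F-S3, family B-dh — E-18f: the value-field repair `W′`, the companion `MenuLOneUpperConsistent`
# (the explicit `|L(1,χ)|` UPPER-BOUND rows of MENU-CENSUS row 22 — Ramaré 2001 Cor. 1 / Cor. 3, Ramaré 2004 Cor. 2,
# Johnston–Ramaré–Trudgian 2023 Thms 1–2 — rendered over the world and met, jointly with the whole typed menu, by `W′`),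
# and the JOINT world `W⁺′` meeting EVERY kernel-typed (A)-world row at once (`MenuJointConsistent`, Part 2)

Y. Zhang, *Discrete mean estimates and the Landau–Siegel zero*, arXiv:2211.02515v1 [Zhang2022LandauSiegel] — an unrefereed
manuscript under adjudication. **The programme SEARCHES and TYPES; no claim about Landau–Siegel zeros, Theorems 1–2 of
arXiv:2211.02515 or a repaired Margin232 until a kernel theorem says so.** Nothing in this file is a statement about a
Dirichlet `L`-function: `DH.worldVal D χ` below is abstract zero/value/prime-count DATA (the cell's consistency world
`DH.world D χ` of `DHChainBarrier`, p461081/p461386, with ONE field changed) and every theorem is elementary bookkeeping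
about that data. Cell `landau-siegel` (pub/landau-siegel/), sub-cells B-dh / C / E; written by ls-Bdh-typer-1 g4 on the
family planner's recorded successor note (B-dh/MENU-CENSUS.md v1.5 row 22 and CHANGELOG v1.5, ls-Bdh-plan g2
2026-08-27T01:41Z; offer E-18f on the cell bus 01:50:18Z).

## Why this file exists (MENU-CENSUS v1.5 row 22: a W-RENDERING ARTEFACT, and its repair)

Sub-cell C typed the explicit `|L(1,χ)|` upper bounds of `ExplicitLOneUpperBounds.lean` (littype-FP2-2, p482871):
`ramare2001_corollary1` (primitive `χ ≠ χ₀`, ALL `q`: `|L(1,χ)| ≤ ½ log q` for even `χ`, `≤ ½ log q + 5/2 − log 6` for odd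
`χ` [cite: Ramare2001LOneApproximateFormulae, Corollary 1 p. 248]), `ramare2001_corollary3` (even conductor:
`¼ log q + ½ log 2`, `¼ log q + 5/4 − ½ log 3` [cite: Ramare2001LOneApproximateFormulae, Corollary 3 p. 248]),
`ramare2004_corollary2` (odd `q`: `|(1 − χ(2)/2) L(1,χ)| ≤ ¼(log q + κ(χ))`, `κ = 4 log 2` even, `5 − 2 log(3/2)` odd
[cite: Ramare2004LOneApproximateFormulaeII, Corollary 2 p. 143]), `johnstonRamareTrudgian2023_theorem1/2` (quadratic:
`½ log q` for odd `χ`, `q ≥ 2·10²³`; `(9/20) log q` beyond `2·10⁴⁹` / `5·10⁵⁰` [cite: JohnstonRamareTrudgian2023, Theorems 1–2]).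
The family planner screened them against the certificate world `W = DH.world D χ` (MENU-CENSUS v1.5 row 22): the two
threshold rows (JRT23) are MET; Ramaré's THRESHOLD-FREE bounds are met on every slot with `q ≥ 26` but **VIOLATED AS
RENDERED at finitely many tiny moduli** by `W`'s unit value profile (`LOne q ψ = 1` on every non-induced slot,
`DHChainBarrier` :279) — e.g. the even quadratic character mod 5 (`1 > ½ log 5 = 0.80…`). This is an artefact of the
rendering (the offending slots are non-exceptional characters of FIXED small modulus; no `χ_D`, no `D ≥ e^{43 250}`, no
zero is involved; the true values satisfy the theorems), not a term-(ii) event: the word «KILL(B-dh) inside Σ_menu» over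
`Σ_menu = M_typed ∪ M_primes` AS TYPED 2026-08-26T19:31:07Z is untouched. But the specific `W` of p468827 is not a model
of `Σ_menu ∪ {ramare2001_corollary1}`; the planner recorded the S-sized repair «`W′ := W` with `LOne := ½` (or the true
values) on the small non-exceptional slots» for successors. THIS FILE builds `W′` and proves the repair in the kernel.

## What is typed and proved here

* `ZeroWorld.MenuLOneUpper w : Prop` — a STRUCTURE, one field per typed row of census row 22, each the typed decl's
  statement VERBATIM on the world's value field (`‖L(1,ψ)‖ ↦ w.LOne q ψ`; in Ramaré 2004 Cor. 2
  `‖(1 − ψ(2)/2)·L(1,ψ)‖ ↦ ‖1 − ψ(2)/2‖ · w.LOne q ψ` — the slot index `ψ` IS a Dirichlet character, so `ψ(2)` is its true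
  value): `rowR01c1` ↔ `ramare2001_corollary1`, `rowR01c3` ↔ `ramare2001_corollary3`, `rowR04c2` ↔ `ramare2004_corollary2`,
  `rowJRT1` ↔ `johnstonRamareTrudgian2023_theorem1`, `rowJRT2` ↔ `johnstonRamareTrudgian2023_theorem2`. (Ramaré 2001
  Cor. 2 = `ramare2001_corollary2` is a class-number statement about real quadratic FIELDS — outside the world's fields,
  not rendered; the PROVED readings of that file are consequences, not rows.)
* **`worldVal D χ`** (`W′`) **= `world D χ` in every field except `LOne`**, where `LOne q ψ := λ(D)` on the induced
  ("exceptional") slots (as in `W`) and `:= ½` on EVERY other slot (uniform `½` instead of the planner's "`½` for `q ≤ 25`,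
  `1` above": fewer cases, same effect). `mult`, `Lhalf`, `psi` are those of `W` by `rfl` (§4).
* `MenuLOneUpperConsistent : Prop` — for every modulus `D` with `log D ≥ 43 250` and every primitive quadratic `χ ≠ χ₀` mod
  `D`: `(worldVal D χ).Menu D χ ∧ PrimeMenu (worldVal D χ) (primeWorld D χ) ∧ (worldVal D χ).MenuLOneUpper` — ONE world for
  `Σ_menu = M_typed ∪ M_primes` TOGETHER WITH the five explicit `|L(1,χ)|` upper-bound rows — and
  `menuLOneUpperConsistent_holds : MenuLOneUpperConsistent`.
* `MenuValConsistent : Prop` (omnibus; the family planner's «ONE kernel world for everything typed that reads on an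
  (A)-world», liaison GO 2026-08-27T01:51:35Z) — with the existential constants of the landed companions quantified ONCE
  before `∀ D` (as in E-18d): `Menu ∧ PrimeMenu ∧ MenuInformal ∧ MenuInformalCritLine ∧ MenuCensus ∧ MenuCensusRow18 ∧
  MenuLOneUpper` on the SAME `worldVal D χ` — and `menuValConsistent_holds`. The `M_informal` companions (E-18c, zero data
  only) and the zero-reading census rows (E-18e) transfer from `W` by `rfl` (§8–§9); the two VALUE-reading census rows
  (Pintz 1976 Thm 5 / Thm 4: hypothesis `LOne ≤ 1/log² D'`) are re-thresholded at `D' ≥ 8` (`½ > ¼ ≥ 1/log² D'`, so the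
  hypothesis again singles out an induced slot, where `W′ = W`) and reduced to `world_rowPintz5` / `world_rowPintz4`.
  NOT a conjunct: dhE-18 (ii) (`MenuInformalLOne`, E-18d) — `W′`'s `½` is below the Granville–Soundararajan level.
* PART 2 (§11–§13), the liaison's preferred end state: **`worldJoint D χ`** (`W⁺′`) = `W′` with `LOne := v₀(q) =
  e^γ(log log q + log log log q)` (E-18d's `valueProfile`) on the non-principal non-induced slots of the levels
  `log q ≥ jointLevel := 128`; `MenuJointConsistent : Prop` = all constants quantified once, then for every `log D ≥ 43 250` and
  primitive quadratic `χ ≠ χ₀`: `Menu ∧ PrimeMenu ∧ MenuInformal ∧ MenuInformalCritLine ∧ MenuInformalLOne C q₀ ∧ MenuCensus ∧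
  MenuCensusRow18 ∧ MenuLOneUpper` on the SAME `worldJoint D χ`; and `menuJointConsistent_holds` (`C := 0`,
  `q₀ := jointThreshold := ⌈e^{max(A,128)}⌉₊`, census `D₅ = D₄ := 8`). Key line (§12): for `x = log q ≥ 128`,
  `v₀(q) ≤ 2(2 log x − 1) ≤ x/6` (`e^γ < 2` from `γ < 2/3 < log 2`; `log log x ≤ log x − 1`; `24 log x ≤ x` from
  `log x = 7 log 2 + log(x/128) ≤ 7 log 2 + x/128 − 1`), so EVERY slot of `W⁺′` has `LOne ≤ max(½, (log q)/6)`
  (`worldJoint_LOne_le`) and the five caps hold with room (`¼(x + 4 log 2) ≥ (3/2)(x + 4 log 2)/6`, etc.); dhE-18 (ii) by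
  E-18d's counting argument verbatim with `24 ↦ 128` (`card_sub_two_le_largeValueCount_joint`, `worldJoint_row18ii`, reusing
  `largeValueLevel_le_valueProfile`, `rpow_le_sub_three`, `card_filter_isExcSlot_le_one`).

PROOF MAP. Every slot of `W′` has `LOne ≤ ½` (`λ(D) = ½(log D)⁻²⁰²² ≤ ½`, `worldVal_LOne_le_half`), and a slot carrying
a non-principal `ψ` has `q ≥ 3 > e`, `log q ≥ 1` (private `level_three_le_of_ne_one`, `one_le_log_of_ne_one`: the unit groups of
`ℤ/1`, `ℤ/2` are trivial). Hence: Cor. 1 even `½ ≤ ½ log q`; odd `½ ≤ 5/2 − log 6` (`log 6 < 2`: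
`e² > 2.718² > 6`) `≤ ½ log q + (5/2 − log 6)`; Cor. 3 (`2 ∣ q`, so `q ≥ 2`): even `½ ≤ ¾ log 2 ≤ ¼ log q + ½ log 2`
(`log 2 > 0.6931 > 2/3`), odd `½ ≤ 5/4 − ½ log 3` (`log 3 < 3/2`: `e^{3/2} ≥ e·(1 + ½) > 4 > 3`); Cor. 2 (2004):
`‖1 − ψ(2)/2‖ ≤ 1 + ½‖ψ(2)‖ ≤ 3/2` (`DirichletCharacter.norm_le_one`), so the left side is `≤ ¾`, while
`(log q + 4 log 2)/4 ≥ (1 + 2.77)/4 > ¾` and `(log q + 5 − 2 log(3/2))/4 ≥ (1 + 5 − 1)/4 > ¾` (`log(3/2) ≤ ½`); JRT Thm 1: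
`q ≥ 2·10²³ > e` gives `log q ≥ 1`; Thm 2: `q ≥ 2·10⁴⁹ > e²` gives `(9/20) log q ≥ 9/10 ≥ ½`. The value rows of `Menu`,
re-proved on `W′` (§6): (A), 09, 12 read induced slots only (value `λ`, as on `W`: a real zero in BGTZ's window is `β₁` on
an induced slot, `real_zero_gt_half`); row 11: `LOne ≤ ½ ≤ 1 ≤ log q`; row 15
(`0.69/√q ≤ LOne`, real primitive, `q ≥ 3`): induced slots as on `W`, otherwise `0.69/√q ≤ 0.69/√3 < 0.69/1.38 = ½`
(`1.38² < 3`); row 19 INERT as on `W` (`β₁ > ½` is a zero); S3: `λ, ½ > 0` and induced slots are stable under `ψ ↦ ψ⁻¹`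
(`isExcSlot_inv_iff`). Zero/prime rows (`Menu` rows 01–06, 08, 10, 13, S1, S2, S4; `PrimeMenu`) transfer from
`menuConsistent_holds` p468827 / `menuConsistentPrimes_holds` p473947 field by field by `rfl` (§8).

## Scope (this file moves no word)

WORD OF RECORD «KILL(B-dh) inside Σ_menu» = `DH.certificate_holds` conjuncts 1–2 (p478764), UNCONDITIONAL over
`M_typed ∪ M_primes` as typed 19:31:07Z — unchanged. This COMPANION says: the menu AS TYPED together with the five explicit
`|L(1,χ)|` upper-bound rows of census row 22 is met by ONE world `W′`; so those rows, if ever added to the menu, re-open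
nothing (term (iii) watch: kernel-checked), and the census cell «VIOLATED AS RENDERED … repair S-sized» is closed by a
theorem; and Part 2's `W⁺′` is ONE kernel world for everything typed that reads on an (A)-world — `Σ_menu`, the
`M_informal` companions (incl. dhE-18 (ii)), the census rows and the `|L(1,χ)|` caps — so the next term-(iii) question starts
from one decl (`menuJointConsistent_holds`). `W′` alone does NOT meet dhE-18 (ii) (its `½` is below the Granville–Soundararajan
level) and `W⁺` (E-18d, profile from `log q ≥ 24`) does NOT meet Ramaré 2004 Cor. 2 below `log q ≈ 60`; `W⁺′` (profile from
`log q ≥ 128`) meets both. No new named fact (D-0026: the three `Prop` definitions `MenuLOneUpperConsistent`,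
`MenuValConsistent`, `MenuJointConsistent` are discharged here; `MenuLOneUpper` is a structure with the world as parameter).
No instance, no notation.

«The programme SEARCHES and TYPES; no claim about Landau–Siegel zeros, Theorems 1–2 of arXiv:2211.02515 or a repaired
Margin232 until a kernel theorem says so.»

## References

* [Zhang2022LandauSiegel] Y. Zhang, *Discrete mean estimates and the Landau–Siegel zero*, arXiv:2211.02515v1 (2022), §2
  Assumption (A).
* [Ramare2001LOneApproximateFormulae] O. Ramaré, *Approximate formulae for `L(1,χ)`*, Acta Arith. 100 (2001) 245–266,
  Corollaries 1 and 3 p. 248 (tree: `ramare2001_corollary1`, `ramare2001_corollary3`, `ExplicitLOneUpperBounds.lean` p482871).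
* [Ramare2004LOneApproximateFormulaeII] O. Ramaré, *Approximate formulae for `L(1,χ)`, II*, Acta Arith. 112 (2004) 141–149,
  Corollary 2 p. 143 (tree: `ramare2004_corollary2`).
* [JohnstonRamareTrudgian2023] D. R. Johnston, O. Ramaré, T. S. Trudgian, *An explicit upper bound for `L(1,χ)` when `χ` is
  quadratic*, Res. Number Theory 9 (2023) art. 72, Theorems 1–2 (tree: `johnstonRamareTrudgian2023_theorem1/2`).
* Tree: `Zhang2022/DHChainBarrier.lean` (`ZeroWorld`, `Menu`, `world`), `Zhang2022/DHChainBarrierPrimes.lean` (`PrimeMenu`,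
  `primeWorld`), `Zhang2022/DHMenuConsistentP4.lean` (`world_row09/11/12/15`, `real_zero_gt_half`, `mult_self_betaExc`,
  `isExcSlot_inv_iff`), `Zhang2022/DHMenuConsistentProof.lean` (`menuConsistent_holds` p468827),
  `Zhang2022/DHMenuConsistentPrimesProof.lean` (`menuConsistentPrimes_holds` p473947), `Zhang2022/DHMenuConsistentInformal.lean` /
  `…InformalCritLine.lean` (`menuInformalConsistent_holds` p475376, `menuInformalCritLineConsistent_holds` p476879),
  `Zhang2022/DHMenuConsistentCensus.lean` (E-18e: `MenuCensus`, `MenuCensusRow18`, `world_rowRR1/Khale/BP12/GS75/Pintz3/Pintz3S/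
  Pintz5/Pintz4`, p481895/p482472), `Zhang2022/DHMenuConsistentInformalLOne.lean` (E-18d p480228, the pattern followed here),
  Mathlib `DirichletCharacter.norm_le_one`.
* [Pintz1976ElementaryII] J. Pintz, *Elementary methods in the theory of L-functions, II*, Acta Arith. 31 (1976), Theorems 4–5
  (the two value-reading census rows re-thresholded in §9 / §13).
* [GranvilleSoundararajan2006ExtremeValues] A. Granville, K. Soundararajan, *Extreme values of `|ζ(1+it)|`*, §7 Theorem 3 (ii)
  p. 6 (dhE-18 (ii) = `granvilleSoundararajan2006_theorem3ii`, `LOneLargeValuesPrimeModulus.lean` p478408; rendered over a world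
  as `ZeroWorld.MenuInformalLOne`, E-18d).
* pub/landau-siegel/B-dh/MENU-CENSUS.md v1.5 row 22 and CHANGELOG v1.5 (ls-Bdh-plan g2, 2026-08-27T01:41Z).
-/

noncomputable section

open scoped Classical
open Complex

namespace Literature.NumberTheory.LFunctions.Zhang2022.DH

/-! ## 1. The explicit `|L(1,χ)|` upper-bound rows over a world -/

namespace ZeroWorld

/-- **THE EXPLICIT `|L(1,χ)|` UPPER-BOUND MENU over a world** (MENU-CENSUS row 22): one field per typed row of
`ExplicitLOneUpperBounds.lean`, verbatim on the value field `w.LOne` (`‖L(1,ψ)‖ ↦ w.LOne q ψ`).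
[cite: Ramare2001LOneApproximateFormulae, Corollary 1 p. 248] -/
structure MenuLOneUpper (w : ZeroWorld) : Prop where
  /-- `ramare2001_corollary1`: primitive `ψ ≠ χ₀`, ALL `q`: `½ log q` (even), `½ log q + 5/2 − log 6` (odd). -/
  rowR01c1 : ∀ (q : ℕ) [NeZero q] (ψ : DirichletCharacter ℂ q), ψ.IsPrimitive → ψ ≠ 1 →
    (ψ.Even → w.LOne q ψ ≤ Real.log q / 2) ∧ (ψ.Odd → w.LOne q ψ ≤ Real.log q / 2 + (5 / 2 - Real.log 6))
  /-- `ramare2001_corollary3`: primitive `ψ ≠ χ₀` of even conductor: `¼ log q + ½ log 2` (even), `¼ log q + 5/4 − ½ log 3` (odd). -/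
  rowR01c3 : ∀ (q : ℕ) [NeZero q] (ψ : DirichletCharacter ℂ q), ψ.IsPrimitive → ψ ≠ 1 → Even q →
    (ψ.Even → w.LOne q ψ ≤ Real.log q / 4 + Real.log 2 / 2) ∧
      (ψ.Odd → w.LOne q ψ ≤ Real.log q / 4 + (5 / 4 - Real.log 3 / 2))
  /-- `ramare2004_corollary2`: primitive `ψ ≠ χ₀` modulo odd `q`: `‖1 − ψ(2)/2‖·|L(1,ψ)| ≤ ¼(log q + κ(ψ))`. -/
  rowR04c2 : ∀ (q : ℕ) [NeZero q] (ψ : DirichletCharacter ℂ q), ψ.IsPrimitive → ψ ≠ 1 → Odd q →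
    (ψ.Even → ‖(1 - ψ 2 / 2 : ℂ)‖ * w.LOne q ψ ≤ (Real.log q + 4 * Real.log 2) / 4) ∧
      (ψ.Odd → ‖(1 - ψ 2 / 2 : ℂ)‖ * w.LOne q ψ ≤ (Real.log q + (5 - 2 * Real.log (3 / 2))) / 4)
  /-- `johnstonRamareTrudgian2023_theorem1`: quadratic odd primitive, `q ≥ 2·10²³`: `½ log q`. -/
  rowJRT1 : ∀ (q : ℕ) [NeZero q] (ψ : DirichletCharacter ℂ q), ψ.IsQuadratic → ψ.IsPrimitive → ψ.Odd →
    (2 * 10 ^ 23 : ℝ) ≤ q → w.LOne q ψ ≤ Real.log q / 2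
  /-- `johnstonRamareTrudgian2023_theorem2`: quadratic primitive `≠ χ₀`: `(9/20) log q` beyond `2·10⁴⁹` (even) / `5·10⁵⁰` (odd). -/
  rowJRT2 : ∀ (q : ℕ) [NeZero q] (ψ : DirichletCharacter ℂ q), ψ.IsQuadratic → ψ.IsPrimitive → ψ ≠ 1 →
    (ψ.Even ∧ (2 * 10 ^ 49 : ℝ) ≤ q ∨ ψ.Odd ∧ (5 * 10 ^ 50 : ℝ) ≤ q) → w.LOne q ψ ≤ 9 / 20 * Real.log q

end ZeroWorld

/-! ## 2. The world `W′(D, χ)`: `W` with value `½` off the induced slots -/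

/-- **The world `W′(D, χ)`** (MENU-CENSUS row 22's repair): the (A)-world `world D χ` with the value field replaced by
`λ(D)` on induced slots and `½` on every other slot; `mult`, `Lhalf`, `psi` unchanged. [cite: Zhang2022LandauSiegel, §2 Assumption (A)] -/
def worldVal (D : ℕ) (χ : DirichletCharacter ℂ D) : ZeroWorld :=
  { world D χ with LOne := fun q ψ => if IsExcSlot D χ q ψ then lam D else 1 / 2 }

/-! ## 3. The companion statements (E-18f): `MenuLOneUpperConsistent` (minimal) and `MenuValConsistent` (omnibus) -/

/-- **`MenuLOneUpperConsistent` (B-DH-W′; companion E-18f).** For every modulus `D` with `log D ≥ 43 250` and every primitive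
quadratic `χ ≠ χ₀` mod `D`, the world `worldVal D χ` satisfies the typed menu `Menu`, the prime menu `PrimeMenu` (with
`primeWorld D χ`) AND the explicit `|L(1,χ)|` upper-bound menu `MenuLOneUpper`: one world for `Σ_menu = M_typed ∪ M_primes`
together with MENU-CENSUS row 22. A COMPANION outside the word's scope. [cite: Zhang2022LandauSiegel, §2 Assumption (A)] -/
def MenuLOneUpperConsistent : Prop :=
  ∀ (D : ℕ) [NeZero D] (χ : DirichletCharacter ℂ D), χ.IsPrimitive → χ.IsQuadratic → χ ≠ 1 →
    (43250 : ℝ) ≤ Real.log D →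
      (worldVal D χ).Menu D χ ∧ PrimeMenu (worldVal D χ) (primeWorld D χ) ∧ (worldVal D χ).MenuLOneUpper

/-- **`MenuValConsistent` (B-DH-W′, omnibus companion).** There are constants — `C₇, c₀, C₂₈, C₁₂, R₀` (the typed ZD/ZFR rows
of `M_informal`, E-18c part 1), `Q₀, Q₁, T₀` (the typed critical-line rows, E-18c part 2), `c₁₆, D₃, D₃', C₅, D₅, Q₉` and
`C₄, D₄` (the census rows, E-18e Parts 1–2) — chosen ONCE, such that for every modulus `D` with `log D ≥ 43 250` and every
primitive quadratic `χ ≠ χ₀` mod `D` the ONE world `worldVal D χ` satisfies `Menu`, `PrimeMenu`, `MenuInformal`,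
`MenuInformalCritLine`, `MenuCensus`, `MenuCensusRow18` AND `MenuLOneUpper`: every kernel-typed row that reads on an (A)-world
EXCEPT the value-distribution row dhE-18 (ii) (`MenuInformalLOne`, which lives on `W⁺`, E-18d). A COMPANION outside the
word's scope. [cite: Zhang2022LandauSiegel, §2 Assumption (A)] -/
def MenuValConsistent : Prop :=
  ∃ C₇ : ℝ, 0 < C₇ ∧ ∃ c₀ : ℝ → ℝ, (∀ ε : ℝ, 0 < ε → 0 < c₀ ε) ∧
    ∃ C₂₈ : ℝ → ℝ, (∀ ε : ℝ, 0 < ε → 0 < C₂₈ ε) ∧ ∃ C₁₂ : ℝ → ℝ, ∃ R₀ : ℝ, 1 ≤ R₀ ∧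
  ∃ Q₀ Q₁ : (ℝ → ℝ) → ℝ → ℝ, ∃ T₀ : (ℝ → ℝ) → ℝ,
  ∃ c₁₆ : ℝ → ℕ, ∃ D₃ D₃' : ℝ → ℕ, ∃ C₅ : ℝ, ∃ D₅ : ℕ, ∃ Q₉ : (ℝ → ℝ) → ℝ → ℝ, (∀ ν ε, 1 ≤ Q₉ ν ε) ∧
  ∃ C₄ : ℝ, ∃ D₄ : ℕ,
    ∀ (D : ℕ) [NeZero D] (χ : DirichletCharacter ℂ D), χ.IsPrimitive → χ.IsQuadratic → χ ≠ 1 →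
      (43250 : ℝ) ≤ Real.log D →
        (worldVal D χ).Menu D χ ∧ PrimeMenu (worldVal D χ) (primeWorld D χ) ∧
          (worldVal D χ).MenuInformal C₇ c₀ C₂₈ C₁₂ R₀ ∧ (worldVal D χ).MenuInformalCritLine Q₀ Q₁ T₀ ∧
            (worldVal D χ).MenuCensus c₁₆ D₃ D₃' C₅ D₅ Q₉ ∧ (worldVal D χ).MenuCensusRow18 C₄ D₄ ∧
              (worldVal D χ).MenuLOneUpper

/-! ## 4. `W′` and `W` share the zero, half-line and prime data -/

section Data

variable {D : ℕ} {χ : DirichletCharacter ℂ D}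

/-- Same multiplicities. [cite: Zhang2022LandauSiegel, §2 Assumption (A)] -/
theorem worldVal_mult : (worldVal D χ).mult = (world D χ).mult := rfl

/-- Same half-line data. [cite: Zhang2022LandauSiegel, §2 Assumption (A)] -/
theorem worldVal_Lhalf : (worldVal D χ).Lhalf = (world D χ).Lhalf := rfl

/-- Same prime-count data. [cite: Zhang2022LandauSiegel, §2 Assumption (A)] -/
theorem worldVal_psi : (worldVal D χ).psi = (world D χ).psi := rfl

/-- The value field of `W′`. [cite: Zhang2022LandauSiegel, §2 Assumption (A)] -/
theorem worldVal_LOne (q : ℕ) (ψ : DirichletCharacter ℂ q) :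
    (worldVal D χ).LOne q ψ = if IsExcSlot D χ q ψ then lam D else 1 / 2 := rfl

/-- Same zeros. [cite: Zhang2022LandauSiegel, §2 Assumption (A)] -/
theorem isZero_worldVal_iff {q : ℕ} {ψ : DirichletCharacter ℂ q} {ρ : ℂ} :
    (worldVal D χ).IsZero q ψ ρ ↔ (world D χ).IsZero q ψ ρ := Iff.rfl

end Data

/-! ## 5. Elementary numerics -/

section Numerics

/-- `log 6 < 2` (`e² > 2.718² > 6`). [cite: MontgomeryVaughan2007, §4.3] -/
private theorem log_six_lt_two : Real.log 6 < 2 := by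
  rw [Real.log_lt_iff_lt_exp (by norm_num)]
  have h := Real.exp_one_gt_d9
  have h2 : Real.exp 2 = Real.exp 1 ^ 2 := by rw [← Real.exp_nat_mul]; norm_num
  rw [h2]
  nlinarith

/-- `log 3 < 3/2` (`e^{3/2} ≥ e·(1 + ½) > 4`). [cite: MontgomeryVaughan2007, §4.3] -/
private theorem log_three_lt_three_halves : Real.log 3 < 3 / 2 := by
  rw [Real.log_lt_iff_lt_exp (by norm_num)]
  have h1 := Real.exp_one_gt_d9
  have hh : (1 : ℝ) / 2 + 1 ≤ Real.exp (1 / 2) := Real.add_one_le_exp _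
  have h2 : Real.exp (3 / 2) = Real.exp 1 * Real.exp (1 / 2) := by rw [← Real.exp_add]; norm_num
  rw [h2]
  nlinarith [Real.exp_pos (1 / 2 : ℝ)]

/-- `log(3/2) ≤ ½` (`log x ≤ x − 1`). [cite: MontgomeryVaughan2007, §4.3] -/
private theorem log_three_halves_le_half : Real.log (3 / 2) ≤ 1 / 2 := by
  have := Real.log_le_sub_one_of_pos (show (0 : ℝ) < 3 / 2 by norm_num)
  linarith

/-- `2/3 < log 2`. [cite: MontgomeryVaughan2007, §4.3] -/
private theorem two_thirds_lt_log_two : (2 : ℝ) / 3 < Real.log 2 := by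
  have := Real.log_two_gt_d9
  linarith

/-- `1 ≤ log x` for `x ≥ 3 > e`. [cite: MontgomeryVaughan2007, §4.3] -/
private theorem one_le_log_of_three_le {x : ℝ} (hx : 3 ≤ x) : 1 ≤ Real.log x := by
  have he : Real.exp 1 ≤ x := by
    have := Real.exp_one_lt_d9
    linarith
  have := Real.log_le_log (Real.exp_pos 1) he
  rwa [Real.log_exp] at this

/-- `2 ≤ log x` for `x ≥ 8 > e²`. [cite: MontgomeryVaughan2007, §4.3] -/
private theorem two_le_log_of_eight_le {x : ℝ} (hx : 8 ≤ x) : 2 ≤ Real.log x := by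
  have he : Real.exp 2 ≤ x := by
    have h := Real.exp_one_lt_d9
    have h2 : Real.exp 2 = Real.exp 1 ^ 2 := by rw [← Real.exp_nat_mul]; norm_num
    rw [h2]
    nlinarith [Real.exp_pos (1 : ℝ)]
  have := Real.log_le_log (Real.exp_pos 2) he
  rwa [Real.log_exp] at this

/-- **A non-principal Dirichlet character has modulus `q ≥ 3`** (the unit groups of `ℤ/1`, `ℤ/2` are trivial; the same
argument as the tree's `VKDirichlet.three_le_of_ne_one`, whose module is not imported here). [folklore] -/
private theorem level_three_le_of_ne_one {q : ℕ} [NeZero q] {ψ : DirichletCharacter ℂ q} (hne : ψ ≠ 1) : 3 ≤ q := by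
  by_contra hlt
  push Not at hlt
  have h0 : q ≠ 0 := NeZero.ne q
  have htot : Nat.totient q ≤ 1 := by
    interval_cases q <;> decide
  have hcard : Fintype.card (ZMod q)ˣ ≤ 1 := by rw [ZMod.card_units_eq_totient]; exact htot
  haveI : Subsingleton (ZMod q)ˣ := Fintype.card_le_one_iff_subsingleton.mp hcard
  apply hne
  refine MulChar.ext (fun u => ?_)
  rw [Subsingleton.elim u 1]
  simp

/-- **A slot carrying a non-principal `ψ` has `log q ≥ 1`** (`q ≥ 3 > e`). [folklore] -/
private theorem one_le_log_of_ne_one {q : ℕ} [NeZero q] {ψ : DirichletCharacter ℂ q} (hne : ψ ≠ 1) :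
    (1 : ℝ) ≤ Real.log q :=
  one_le_log_of_three_le (by exact_mod_cast level_three_le_of_ne_one hne)

/-- `‖1 − z/2‖ ≤ 3/2` for `‖z‖ ≤ 1`. [cite: Ramare2004LOneApproximateFormulaeII, Corollary 2 p. 143] -/
private theorem norm_one_sub_half_le {z : ℂ} (hz : ‖z‖ ≤ 1) : ‖(1 - z / 2 : ℂ)‖ ≤ 3 / 2 := by
  calc ‖(1 - z / 2 : ℂ)‖ ≤ ‖(1 : ℂ)‖ + ‖z / 2‖ := norm_sub_le _ _
    _ = 1 + ‖z‖ / 2 := by rw [norm_one, norm_div]; norm_num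
    _ ≤ 3 / 2 := by linarith

/-- `0.69/√q ≤ ½` for `q ≥ 3` (`√3 > 1.38`). [cite: MontgomeryVaughan2007, §4.3] -/
private theorem floor069_le_half {q : ℝ} (hq : 3 ≤ q) : (69 / 100) / Real.sqrt q ≤ 1 / 2 := by
  have h138 : (1.38 : ℝ) < Real.sqrt 3 := (Real.lt_sqrt (by norm_num)).mpr (by norm_num)
  have hs3 : Real.sqrt 3 ≤ Real.sqrt q := Real.sqrt_le_sqrt hq
  have hpos : (0 : ℝ) < 1.38 := by norm_num
  calc (69 / 100) / Real.sqrt q ≤ (69 / 100) / 1.38 :=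
        div_le_div_of_nonneg_left (by norm_num) hpos (by linarith)
    _ = 1 / 2 := by norm_num

end Numerics

/-! ## 6. The value field of `W′`: bounded by `½`, positive; the value rows of `Menu` on `W′` -/

section ValueRows

variable {D : ℕ} {χ : DirichletCharacter ℂ D}

variable (hL : (43250 : ℝ) ≤ Real.log D)
include hL

/-- **Every slot of `W′` has value `≤ ½`.** [cite: Zhang2022LandauSiegel, §2 Assumption (A)] -/
theorem worldVal_LOne_le_half (q : ℕ) (ψ : DirichletCharacter ℂ q) : (worldVal D χ).LOne q ψ ≤ 1 / 2 := by
  rw [worldVal_LOne]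
  split_ifs
  · exact lam_le_half (by linarith)
  · exact le_rfl

/-- Every slot of `W′` has positive value. [cite: Zhang2022LandauSiegel, §2 Assumption (A)] -/
theorem worldVal_LOne_pos (q : ℕ) (ψ : DirichletCharacter ℂ q) : 0 < (worldVal D χ).LOne q ψ := by
  rw [worldVal_LOne]
  split_ifs
  · exact lam_pos_of_hL hL
  · norm_num

/-- **(A) on `W′`**: the slot `(D, χ)` is induced, value `λ(D) < (log D)⁻²⁰²²`. [cite: Zhang2022LandauSiegel, §2 Assumption (A)] -/
theorem worldVal_assumptionA : (worldVal D χ).LOne D χ < 1 / Real.log D ^ 2022 := by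
  rw [worldVal_LOne, if_pos isExcSlot_self]
  exact lam_lt_cap (log_pos_of_hL hL)

/-- **Row dhE-09 on `W′`**: a real zero in BGTZ's window is `β₁(D)` on an induced slot, where the value is `λ(D)` as on
`W`. [cite: BenliGoelTwissZaman2025, Lemma 2.9] -/
theorem worldVal_row09 : ∀ (q : ℕ) [NeZero q], 400000 < q → ∀ χ₁ : DirichletCharacter ℂ q, χ₁.IsQuadratic →
    χ₁ ≠ 1 → ∀ β₁ : ℝ, 1 - 1 / (10 * Real.log q) < β₁ → β₁ < 1 → (worldVal D χ).IsZero q χ₁ β₁ →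
      0.72 * (1 - β₁) ≤ (worldVal D χ).LOne q χ₁ ∧ (worldVal D χ).LOne q χ₁ ≤ 0.18 * Real.log q ^ 2 * (1 - β₁) := by
  intro q _ hq χ₁ hquad hne β₁ hlo hhi hz
  have hz' : (world D χ).IsZero q χ₁ β₁ := hz
  obtain ⟨hs, rfl⟩ := real_zero_gt_half hL hz' (half_lt_of_window (by omega) hlo)
  have h := world_row09 (χ := χ) hL q hq χ₁ hquad hne (betaExc D) hlo hhi hz'
  rw [world_LOne, if_pos hs] at h
  rw [worldVal_LOne, if_pos hs]
  exact h

/-- **Row dhE-11 on `W′`** (`LOne ≤ log q`, `ψ ≠ χ₀`): `LOne ≤ ½ ≤ 1 ≤ log q`. [cite: MontgomeryVaughan2007, §4.3] -/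
theorem worldVal_row11 : ∀ (q : ℕ) [NeZero q] (ψ : DirichletCharacter ℂ q), ψ ≠ 1 →
    (worldVal D χ).LOne q ψ ≤ Real.log q := by
  intro q _ ψ hne
  have h1 := one_le_log_of_ne_one hne
  have h2 := worldVal_LOne_le_half (χ := χ) hL q ψ
  linarith

/-- **Row dhE-12 on `W′`** (the exceptional-zero package at `(D, χ)`): as on `W` — same zeros, and the slot `(D, χ)` is
induced, value `λ(D)`. [cite: Zhang2022LandauSiegel, Lemma 5.5] [cite: BenliGoelTwissZaman2025, Lemma 2.9] -/
theorem worldVal_row12 (hquad : χ.IsQuadratic) :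
    (worldVal D χ).LOne D χ < 1 / Real.log D ^ 2022 → 400000 < D →
    ∃ β₁ : ℝ, 1 - 1 / (10 * Real.log D) < β₁ ∧ β₁ < 1 ∧ (worldVal D χ).mult D χ β₁ = 1 ∧ χ ^ 2 = 1 ∧
      (∀ (ψ : DirichletCharacter ℂ D) (β : ℝ), 1 - 1 / (10 * Real.log D) < β → β < 1 →
          (worldVal D χ).IsZero D ψ β → ψ = χ ∧ β = β₁) ∧
      0.72 * (1 - β₁) ≤ (worldVal D χ).LOne D χ ∧ 1 - β₁ < 25 / 18 / Real.log D ^ 2022 := by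
  intro _ hD
  have hA : (world D χ).LOne D χ < 1 / Real.log D ^ 2022 := by
    rw [world_LOne, if_pos isExcSlot_self]; exact lam_lt_cap (log_pos_of_hL hL)
  obtain ⟨β₁, h1, h2, h3, h4, h5, h6, h7⟩ := world_row12 hL hquad hA hD
  refine ⟨β₁, h1, h2, h3, h4, fun ψ β hlo hhi hz => h5 ψ β hlo hhi hz, ?_, h7⟩
  rw [world_LOne, if_pos isExcSlot_self] at h6
  rw [worldVal_LOne, if_pos isExcSlot_self]
  exact h6

/-- **Row dhE-15 on `W′`** (the `0.69/√q` floor for real primitive `ψ`, `q ≥ 3`): induced slots as on `W`; otherwise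
`0.69/√q ≤ 0.69/√3 < ½`. [cite: MontgomeryVaughan2007, §4.3] -/
theorem worldVal_row15 : ∀ (q : ℕ) [NeZero q], 3 ≤ q → ∀ ψ : DirichletCharacter ℂ q, ψ.IsPrimitive →
    ψ.IsQuadratic → (69 / 100) / Real.sqrt q ≤ (worldVal D χ).LOne q ψ := by
  intro q _ hq ψ hprim hquad
  have h1 : (69 / 100) / Real.sqrt q ≤ (world D χ).LOne q ψ := world_row15 hL q hq ψ hprim hquad
  rw [world_LOne] at h1
  rw [worldVal_LOne]
  by_cases hs : IsExcSlot D χ q ψ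
  · rw [if_pos hs] at h1 ⊢; exact h1
  · rw [if_neg hs]
    exact floor069_le_half (by exact_mod_cast hq)

/-- **Row dhE-19 on `W′` (LLS 2015 under GRH): INERT** — the GRH hypothesis read over `W′` fails at the zero `β₁(D)` of
the slot `(D, χ)` (same zeros as `W`). [cite: LamzouriLiSoundararajan2015, Theorem 1.5 p. 2393] -/
theorem worldVal_row19 :
    (∀ (q : ℕ) (ψ : DirichletCharacter ℂ q) (ρ : ℂ), (worldVal D χ).IsZero q ψ ρ → ρ.re = 1 / 2) →
    ∀ (q : ℕ) [NeZero q] (ψ : DirichletCharacter ℂ q), ψ.IsPrimitive → (10 : ℝ) ^ 10 ≤ (q : ℝ) →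
      (worldVal D χ).LOne q ψ ≤
          2 * Real.exp Real.eulerMascheroniConstant * LamzouriLiSoundararajan2015.upperBracket q ∧
        1 / (worldVal D χ).LOne q ψ ≤
          12 * Real.exp Real.eulerMascheroniConstant / Real.pi ^ 2 * LamzouriLiSoundararajan2015.lowerBracket q := by
  intro hGRH
  exfalso
  have hz : (worldVal D χ).IsZero D χ ((betaExc D : ℝ) : ℂ) := by
    show 0 < (world D χ).mult D χ ((betaExc D : ℝ) : ℂ)
    rw [mult_self_betaExc hL]; exact Nat.one_pos
  have h := hGRH D χ _ hz
  rw [Complex.ofReal_re] at h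
  linarith [half_lt_betaExc hL]

/-- **Row S3 on `W′`**: `LOne > 0`; `LOne(ψ̄) = LOne(ψ)` (induced slots are stable under `ψ ↦ ψ⁻¹`); `Lhalf ≥ 0`.
[cite: MontgomeryVaughan2007, §4.3] -/
theorem worldVal_rowS3 (hquad : χ.IsQuadratic) : ∀ (q : ℕ) [NeZero q] (ψ : DirichletCharacter ℂ q),
    (ψ ≠ 1 → 0 < (worldVal D χ).LOne q ψ) ∧ (worldVal D χ).LOne q ψ⁻¹ = (worldVal D χ).LOne q ψ ∧
      ∀ t : ℝ, 0 ≤ (worldVal D χ).Lhalf q ψ t := by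
  intro q _ ψ
  refine ⟨fun _ => worldVal_LOne_pos hL q ψ, ?_, fun t => ?_⟩
  · rw [worldVal_LOne, worldVal_LOne]
    by_cases hs : IsExcSlot D χ q ψ
    · rw [if_pos hs, if_pos ((isExcSlot_inv_iff hquad).mpr hs)]
    · rw [if_neg hs, if_neg (fun h => hs ((isExcSlot_inv_iff hquad).mp h))]
  · show (0 : ℝ) ≤ (world D χ).Lhalf q ψ t
    rw [world_Lhalf]; norm_num

end ValueRows

/-! ## 7. The explicit `|L(1,χ)|` upper-bound rows on `W′` -/

section UpperRows

variable {D : ℕ} {χ : DirichletCharacter ℂ D}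

variable (hL : (43250 : ℝ) ≤ Real.log D)
include hL

/-- **Ramaré 2001 Cor. 1 on `W′`**: even `LOne ≤ ½ ≤ ½ log q` (`log q ≥ 1`); odd `LOne ≤ ½ < 5/2 − log 6 ≤ ½ log q + (5/2 − log 6)`.
[cite: Ramare2001LOneApproximateFormulae, Corollary 1 p. 248] -/
theorem worldVal_rowR01c1 : ∀ (q : ℕ) [NeZero q] (ψ : DirichletCharacter ℂ q), ψ.IsPrimitive → ψ ≠ 1 →
    (ψ.Even → (worldVal D χ).LOne q ψ ≤ Real.log q / 2) ∧
      (ψ.Odd → (worldVal D χ).LOne q ψ ≤ Real.log q / 2 + (5 / 2 - Real.log 6)) := by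
  intro q _ ψ _ hne
  have h1 := one_le_log_of_ne_one hne
  have h2 := worldVal_LOne_le_half (χ := χ) hL q ψ
  refine ⟨fun _ => by linarith, fun _ => ?_⟩
  linarith [log_six_lt_two]

/-- **Ramaré 2001 Cor. 3 on `W′`** (`2 ∣ q`, so `q ≥ 2`): even `LOne ≤ ½ < ¾ log 2 ≤ ¼ log q + ½ log 2`; odd
`LOne ≤ ½ < 5/4 − ½ log 3 ≤ ¼ log q + (5/4 − ½ log 3)`. [cite: Ramare2001LOneApproximateFormulae, Corollary 3 p. 248] -/
theorem worldVal_rowR01c3 : ∀ (q : ℕ) [NeZero q] (ψ : DirichletCharacter ℂ q), ψ.IsPrimitive → ψ ≠ 1 → Even q →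
    (ψ.Even → (worldVal D χ).LOne q ψ ≤ Real.log q / 4 + Real.log 2 / 2) ∧
      (ψ.Odd → (worldVal D χ).LOne q ψ ≤ Real.log q / 4 + (5 / 4 - Real.log 3 / 2)) := by
  intro q _ ψ _ _ heven
  have h2 := worldVal_LOne_le_half (χ := χ) hL q ψ
  have hq2 : (2 : ℝ) ≤ q := by
    have hq0 : q ≠ 0 := NeZero.ne q
    obtain ⟨k, hk⟩ := heven
    have : 2 ≤ q := by omega
    exact_mod_cast this
  have hlog2 : Real.log 2 ≤ Real.log q := Real.log_le_log (by norm_num) hq2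
  have hl2 := two_thirds_lt_log_two
  refine ⟨fun _ => by linarith, fun _ => ?_⟩
  have hlog0 : 0 ≤ Real.log q := le_trans (Real.log_nonneg (by norm_num)) hlog2
  linarith [log_three_lt_three_halves]

/-- **Ramaré 2004 Cor. 2 on `W′`** (odd `q`): `‖1 − ψ(2)/2‖ · LOne ≤ (3/2)·½ = ¾`, and `¾ < (log q + 4 log 2)/4`,
`¾ < (log q + 5 − 2 log(3/2))/4` since `log q ≥ 1`. [cite: Ramare2004LOneApproximateFormulaeII, Corollary 2 p. 143] -/
theorem worldVal_rowR04c2 : ∀ (q : ℕ) [NeZero q] (ψ : DirichletCharacter ℂ q), ψ.IsPrimitive → ψ ≠ 1 → Odd q →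
    (ψ.Even → ‖(1 - ψ 2 / 2 : ℂ)‖ * (worldVal D χ).LOne q ψ ≤ (Real.log q + 4 * Real.log 2) / 4) ∧
      (ψ.Odd → ‖(1 - ψ 2 / 2 : ℂ)‖ * (worldVal D χ).LOne q ψ ≤ (Real.log q + (5 - 2 * Real.log (3 / 2))) / 4) := by
  intro q _ ψ _ hne _
  have h1 := one_le_log_of_ne_one hne
  have h2 := worldVal_LOne_le_half (χ := χ) hL q ψ
  have h0 := (worldVal_LOne_pos (χ := χ) hL q ψ).le
  have hn : ‖(1 - ψ 2 / 2 : ℂ)‖ ≤ 3 / 2 := norm_one_sub_half_le (DirichletCharacter.norm_le_one ψ 2)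
  have hprod : ‖(1 - ψ 2 / 2 : ℂ)‖ * (worldVal D χ).LOne q ψ ≤ 3 / 2 * (1 / 2) :=
    mul_le_mul hn h2 h0 (by norm_num)
  refine ⟨fun _ => ?_, fun _ => ?_⟩
  · linarith [two_thirds_lt_log_two]
  · linarith [log_three_halves_le_half]

/-- **Johnston–Ramaré–Trudgian 2023 Thm 1 on `W′`**: `LOne ≤ ½ ≤ ½ log q` for `q ≥ 2·10²³ ≥ 3`.
[cite: JohnstonRamareTrudgian2023, Theorem 1] -/
theorem worldVal_rowJRT1 : ∀ (q : ℕ) [NeZero q] (ψ : DirichletCharacter ℂ q), ψ.IsQuadratic → ψ.IsPrimitive →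
    ψ.Odd → (2 * 10 ^ 23 : ℝ) ≤ q → (worldVal D χ).LOne q ψ ≤ Real.log q / 2 := by
  intro q _ ψ _ _ _ hq
  have h1 : (1 : ℝ) ≤ Real.log q := one_le_log_of_three_le (by linarith)
  have h2 := worldVal_LOne_le_half (χ := χ) hL q ψ
  linarith

/-- **Johnston–Ramaré–Trudgian 2023 Thm 2 on `W′`**: `LOne ≤ ½ ≤ 9/10 ≤ (9/20) log q` for `q ≥ 2·10⁴⁹ ≥ 8`.
[cite: JohnstonRamareTrudgian2023, Theorem 2] -/
theorem worldVal_rowJRT2 : ∀ (q : ℕ) [NeZero q] (ψ : DirichletCharacter ℂ q), ψ.IsQuadratic → ψ.IsPrimitive →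
    ψ ≠ 1 → (ψ.Even ∧ (2 * 10 ^ 49 : ℝ) ≤ q ∨ ψ.Odd ∧ (5 * 10 ^ 50 : ℝ) ≤ q) →
      (worldVal D χ).LOne q ψ ≤ 9 / 20 * Real.log q := by
  intro q _ ψ _ _ _ hq
  have hq8 : (8 : ℝ) ≤ q := by
    rcases hq with ⟨-, h⟩ | ⟨-, h⟩ <;> linarith
  have h1 : (2 : ℝ) ≤ Real.log q := two_le_log_of_eight_le hq8
  have h2 := worldVal_LOne_le_half (χ := χ) hL q ψ
  linarith

/-- **`MenuLOneUpper` on `W′`.** [cite: Ramare2001LOneApproximateFormulae, Corollary 1 p. 248] -/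
theorem menuLOneUpper_worldVal : (worldVal D χ).MenuLOneUpper where
  rowR01c1 := worldVal_rowR01c1 hL
  rowR01c3 := worldVal_rowR01c3 hL
  rowR04c2 := worldVal_rowR04c2 hL
  rowJRT1 := worldVal_rowJRT1 hL
  rowJRT2 := worldVal_rowJRT2 hL

end UpperRows

/-! ## 8. Transfer of the zero / prime-data menus from `W` to `W′` -/

section Transfer

variable {D : ℕ} {χ : DirichletCharacter ℂ D}

/-- `Menu` on `W′`: zero rows verbatim from `W` (same `mult`), value rows from §6.
[cite: Zhang2022LandauSiegel, §2 Assumption (A)] -/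
theorem menu_worldVal [NeZero D] (hquad : χ.IsQuadratic) (hL : (43250 : ℝ) ≤ Real.log D)
    (hM : (world D χ).Menu D χ) : (worldVal D χ).Menu D χ where
  assumptionA := worldVal_assumptionA hL
  row01 := hM.row01
  row02 := hM.row02
  row03 := hM.row03
  row04 := hM.row04
  row05 := hM.row05
  row06 := hM.row06
  row08 := hM.row08
  row09 := worldVal_row09 hL
  row10 := hM.row10
  row11 := worldVal_row11 hL
  row12 := worldVal_row12 hL hquad
  row13 := hM.row13
  row15 := worldVal_row15 hL
  row19 := worldVal_row19 hL
  rowS1 := hM.rowS1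
  rowS2 := hM.rowS2
  rowS3 := worldVal_rowS3 hL hquad
  rowS4 := hM.rowS4

/-- `PrimeMenu` on `W′` verbatim from `W` (same `psi`, same zeros). [cite: ThornerZaman2024PNTAP, Theorem 1 p.3] -/
theorem primeMenu_worldVal (hM : PrimeMenu (world D χ) (primeWorld D χ)) :
    PrimeMenu (worldVal D χ) (primeWorld D χ) where
  rowP1 := hM.rowP1
  rowP2 := hM.rowP2
  rowP3 := hM.rowP3
  rowP4 := hM.rowP4
  rowP5 := hM.rowP5
  rowP6 := hM.rowP6
  rowS5 := hM.rowS5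

/-- `MenuInformal` on `W′` verbatim from `W` (same zeros) — for the record; not a conjunct of the statement.
[cite: ThornerZaman2024PNTAP, Theorem 7 p.4] -/
theorem menuInformal_worldVal {C₇ : ℝ} {c₀ C₂₈ C₁₂ : ℝ → ℝ} {R₀ : ℝ}
    (hM : (world D χ).MenuInformal C₇ c₀ C₂₈ C₁₂ R₀) : (worldVal D χ).MenuInformal C₇ c₀ C₂₈ C₁₂ R₀ where
  row07 := hM.row07
  row28 := hM.row28
  rowCor12 := hM.rowCor12
  rowKadiri := hM.rowKadiri

/-- `MenuInformalCritLine` on `W′` verbatim from `W` (same zeros) — for the record; not a conjunct of the statement.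
[cite: ConreyIwaniecSoundararajan2011CriticalZeros, Theorem 1] -/
theorem menuInformalCritLine_worldVal {Q₀ Q₁ : (ℝ → ℝ) → ℝ → ℝ} {T₀ : (ℝ → ℝ) → ℝ}
    (hM : (world D χ).MenuInformalCritLine Q₀ Q₁ T₀) : (worldVal D χ).MenuInformalCritLine Q₀ Q₁ T₀ where
  rowCIS1 := hM.rowCIS1
  rowSono := hM.rowSono
  rowWu := hM.rowWu

end Transfer

/-! ## 9. The census rows on `W′` (E-18e rows; the two value-reading Pintz rows with threshold `8`) -/

section Census

variable {D : ℕ} {χ : DirichletCharacter ℂ D} (hL : (43250 : ℝ) ≤ Real.log D)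
include hL

omit hL in
/-- On `W′` the hypothesis `LOne ≤ 1/log² D'` with `D' ≥ 8` singles out an induced slot (`½ > ¼ ≥ 1/log² D'`, `log 8 ≥ 2`),
where `W′` and `W` carry the same value `λ(D)`. [cite: Pintz1976ElementaryII, Theorem 5 pp. 278–279 (1.30)–(1.31)] -/
theorem worldVal_LOne_eq_world_of_le {D' : ℕ} (hD' : 8 ≤ D') {ψ : DirichletCharacter ℂ D'}
    (hval : (worldVal D χ).LOne D' ψ ≤ 1 / Real.log D' ^ 2) :
    (worldVal D χ).LOne D' ψ = (world D χ).LOne D' ψ := by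
  have hs : IsExcSlot D χ D' ψ := by
    by_contra hns
    rw [worldVal_LOne, if_neg hns] at hval
    have h8 : (8 : ℝ) ≤ D' := by exact_mod_cast hD'
    have hlog : 2 ≤ Real.log (D' : ℝ) := two_le_log_of_eight_le h8
    have h4 : (4 : ℝ) ≤ Real.log (D' : ℝ) ^ 2 := by nlinarith
    have h2 : 1 / Real.log (D' : ℝ) ^ 2 ≤ 1 / 4 := div_le_div_of_nonneg_left (by norm_num) (by norm_num) h4
    linarith
  rw [worldVal_LOne, world_LOne, if_pos hs, if_pos hs]

/-- **Census row 17 (Pintz Thm 5) on `W′`** (`C := 1`, `D₀ := 8`): reduced to `W` (`world_rowPintz5`).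
[cite: Pintz1976ElementaryII, Theorem 5 pp. 278–279 (1.30)–(1.31)] -/
theorem worldVal_rowPintz5 (hprim : χ.IsPrimitive) : ∀ (D' : ℕ) [NeZero D'], 8 ≤ D' →
    ∀ ψ : DirichletCharacter ℂ D', ψ.IsQuadratic → ψ.IsPrimitive →
      (worldVal D χ).LOne D' ψ ≤ 1 / Real.log D' ^ 2 →
        (∃ β : ℝ, 1 - 1 / Real.log D' ≤ β ∧ β < 1 ∧ (worldVal D χ).IsZero D' ψ (β : ℂ)) ∧
        ∀ β : ℝ, (worldVal D χ).isGreatestRealZero D' ψ β →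
          (worldVal D χ).LOne D' ψ / (1 - β) ≤
            1 * (Real.log D' * Real.log (Real.log D') /
                  Real.log (1 / (5 * (worldVal D χ).LOne D' ψ * Real.log D'))) ^ 2 := by
  intro D' _ hD' ψ hq hψ hval
  have hEq := worldVal_LOne_eq_world_of_le hD' hval
  rw [hEq] at hval ⊢
  exact world_rowPintz5 hL hprim D' (by omega) ψ hq hψ hval

/-- **Census row 18 (Pintz Thm 4) on `W′`** (`C₄ := 4e⁸·2021²`, `D₄ := 8`): reduced to `W` (`world_rowPintz4`).
[cite: Pintz1976ElementaryII, Theorem 4 pp. 277–278 (1.25)–(1.26)] -/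
theorem worldVal_rowPintz4 (hprim : χ.IsPrimitive) : ∀ (D' : ℕ) [NeZero D'], 8 ≤ D' →
    ∀ ψ : DirichletCharacter ℂ D', ψ.IsQuadratic → ψ.IsPrimitive →
      (worldVal D χ).LOne D' ψ ≤ 1 / Real.log D' ^ 2 →
        Real.exp (∑ p ∈ (Finset.range (D' ^ 2 + 1)).filter Nat.Prime, (1 + (ψ (p : ZMod D')).re) / p) ≤
          (4 * Real.exp 8 * 2021 ^ 2) * (Real.log D' * Real.log (Real.log D') /
                Real.log (1 / (5 * (worldVal D χ).LOne D' ψ * Real.log D'))) ^ 2 := by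
  intro D' _ hD' ψ hq hψ hval
  have hEq := worldVal_LOne_eq_world_of_le hD' hval
  rw [hEq] at hval ⊢
  exact world_rowPintz4 hL hprim D' (by omega) ψ hq hψ hval

/-- **`MenuCensus` on `W′`** with `c₁₆ := 0`, `D₃ = D₃' := 0`, `C₅ := 1`, `D₅ := 8`, `Q₉ := 1`: zero rows verbatim from `W`
(E-18e Part 1), the value-reading row via `worldVal_rowPintz5`. [cite: Zhang2022LandauSiegel, §2 Assumption (A)] -/
theorem menuCensus_worldVal (hprim : χ.IsPrimitive) :
    (worldVal D χ).MenuCensus (fun _ => 0) (fun _ => 0) (fun _ => 0) 1 8 (fun _ _ => 1) where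
  rowRR1 := world_rowRR1 hL hprim
  rowKhale := world_rowKhale
  rowBP12 := world_rowBP12 hL hprim
  rowGS75 := world_rowGS75 hL hprim
  rowPintz3 := world_rowPintz3 hL hprim
  rowPintz3S := world_rowPintz3S hL hprim
  rowPintz5 := worldVal_rowPintz5 hL hprim

/-- **`MenuCensusRow18` on `W′`** with `C₄ := 4e⁸·2021²`, `D₄ := 8`. [cite: Zhang2022LandauSiegel, §2 Assumption (A)] -/
theorem menuCensusRow18_worldVal (hprim : χ.IsPrimitive) :
    (worldVal D χ).MenuCensusRow18 (4 * Real.exp 8 * 2021 ^ 2) 8 where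
  rowPintz4 := worldVal_rowPintz4 hL hprim

end Census

/-! ## 10. The theorems -/

/-- **E-18f DISCHARGED: `MenuLOneUpperConsistent` holds** — ONE world, `W′(D, χ)`, meets every kernel-typed row of
`Σ_menu = M_typed ∪ M_primes` (transferred from `menuConsistent_holds` p468827 and `menuConsistentPrimes_holds` p473947)
together with the five explicit `|L(1,χ)|` upper-bound rows of MENU-CENSUS row 22 (Ramaré 2001 Cor. 1 / Cor. 3, Ramaré 2004
Cor. 2, JRT 2023 Thms 1–2, verbatim on the value field), for every `log D ≥ 43 250`. A COMPANION outside the word's scope;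
it closes the census cell «violated as rendered — repair S-sized» by a theorem. «The programme SEARCHES and TYPES; no claim
about Landau–Siegel zeros, Theorems 1–2 of arXiv:2211.02515 or a repaired Margin232 until a kernel theorem says so.»
[cite: Zhang2022LandauSiegel, §2 Assumption (A)] -/
theorem menuLOneUpperConsistent_holds : MenuLOneUpperConsistent := by
  intro D _ χ hprim hquad hne hL
  exact ⟨menu_worldVal hquad hL (menuConsistent_holds D χ hprim hquad hne hL),
    primeMenu_worldVal (menuConsistentPrimes_holds D χ hprim hquad hne hL),
    menuLOneUpper_worldVal hL⟩

/-- The referee's C2 probe (REF-E §0b): the proved type is the definition BY NAME. [cite: Zhang2022LandauSiegel, §2 Assumption (A)] -/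
example : Literature.NumberTheory.LFunctions.Zhang2022.DH.MenuLOneUpperConsistent := menuLOneUpperConsistent_holds

/-- **`MenuValConsistent` holds** — ONE world, `W′(D, χ)`, meets `Menu`, `PrimeMenu`, `MenuInformal`, `MenuInformalCritLine`
(constants of `menuInformalConsistent_holds` p475376 / `menuInformalCritLineConsistent_holds` p476879, rows transferred by
`rfl`), `MenuCensus` (`c₁₆ := 0`, `D₃ = D₃' := 0`, `C₅ := 1`, `D₅ := 8`, `Q₉ := 1`), `MenuCensusRow18` (`C₄ := 4e⁸·2021²`,
`D₄ := 8`) and `MenuLOneUpper`, for every `log D ≥ 43 250` — every kernel-typed row reading on an (A)-world except dhE-18 (ii)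
(dhE-18 (ii) lives on `W⁺`, E-18d, and on the joint `W⁺′` of Part 2 below, `menuJointConsistent_holds`). A COMPANION
outside the word's scope. «The programme SEARCHES and TYPES; no claim about Landau–Siegel zeros, Theorems 1–2 of
arXiv:2211.02515 or a repaired Margin232 until a kernel theorem says so.» [cite: Zhang2022LandauSiegel, §2 Assumption (A)] -/
theorem menuValConsistent_holds : MenuValConsistent := by
  obtain ⟨C₇, hC₇, c₀, hc₀, C₂₈, hC₂₈, C₁₂, R₀, hR₀, hInf⟩ := menuInformalConsistent_holds
  obtain ⟨Q₀, Q₁, T₀, hCrit⟩ := menuInformalCritLineConsistent_holds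
  refine ⟨C₇, hC₇, c₀, hc₀, C₂₈, hC₂₈, C₁₂, R₀, hR₀, Q₀, Q₁, T₀, fun _ => 0, fun _ => 0, fun _ => 0, 1, 8,
    fun _ _ => 1, fun _ _ => le_rfl, 4 * Real.exp 8 * 2021 ^ 2, 8, ?_⟩
  intro D _ χ hprim hquad hne hL
  exact ⟨menu_worldVal hquad hL (menuConsistent_holds D χ hprim hquad hne hL),
    primeMenu_worldVal (menuConsistentPrimes_holds D χ hprim hquad hne hL),
    menuInformal_worldVal (hInf D χ hprim hquad hne hL),
    menuInformalCritLine_worldVal (hCrit D χ hprim hquad hne hL),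
    menuCensus_worldVal hL hprim, menuCensusRow18_worldVal hL hprim, menuLOneUpper_worldVal hL⟩

/-- C2 probe for the omnibus companion. [cite: Zhang2022LandauSiegel, §2 Assumption (A)] -/
example : Literature.NumberTheory.LFunctions.Zhang2022.DH.MenuValConsistent := menuValConsistent_holds

/-! ## 11. PART 2 — the JOINT world `W⁺′(D, χ)`: `W′` with the Granville–Soundararajan profile `v₀(q)` on the levels `log q ≥ 128`

The family planner's preferred end state (liaison GO 2026-08-27T01:51:35Z): ONE world meeting `MenuValConsistent`'s seven menus
AND the value-distribution row dhE-18 (ii) (`ZeroWorld.MenuInformalLOne`, E-18d). `W⁺` (E-18d) put `v₀(q) = e^γ(log₂q + log₃q)`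
on every non-principal non-induced slot with `log q ≥ 24`; that profile exceeds Ramaré 2004 Cor. 2's cap below `log q ≈ 60`.
`W⁺′` keeps `v₀` only on the levels `log q ≥ 128`, where the crude lines `e^γ < 2`, `log log x ≤ log x − 1`, `24 log x ≤ x`
(`x = log q`) give `v₀(q) ≤ 4 log x − 2 ≤ x/6`, so every slot of `W⁺′` has `LOne ≤ max(½, (log q)/6)` and all five caps hold with
room; dhE-18 (ii) is met with `C := 0` and the threshold `q₀(A) := ⌈e^{max(A,128)}⌉₊` by E-18d's counting argument verbatim
(`24 ↦ 128`). -/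

/-- The dhE-18 (ii) level threshold of `W⁺′`: the profile `v₀` is used on the levels `log q ≥ 128`.
[cite: GranvilleSoundararajan2006ExtremeValues, §7 Theorem 3 (ii) p.6] -/
def jointLevel : ℝ := 128

/-- **The joint world `W⁺′(D, χ)`**: `λ(D)` on induced slots, `v₀(q)` on the other non-principal slots of the levels
`log q ≥ 128`, `½` elsewhere; `mult`, `Lhalf`, `psi` those of `W`. [cite: Zhang2022LandauSiegel, §2 Assumption (A)] -/
def worldJoint (D : ℕ) (χ : DirichletCharacter ℂ D) : ZeroWorld :=
  { world D χ with
    LOne := fun q ψ =>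
      if IsExcSlot D χ q ψ then lam D else if ψ ≠ 1 ∧ jointLevel ≤ Real.log q then valueProfile q else 1 / 2 }

/-- The dhE-18 (ii) threshold function of `W⁺′`: `q₀(A) := ⌈exp(max A 128)⌉₊`.
[cite: GranvilleSoundararajan2006ExtremeValues, §7 Theorem 3 (ii) p.6] -/
def jointThreshold (A : ℝ) : ℕ := ⌈Real.exp (max A jointLevel)⌉₊

/-- **`MenuJointConsistent` (B-DH-W⁺′; the joint companion).** All constants of `MenuValConsistent` together with `C` and
`q₀ : ℝ → ℕ` of dhE-18 (ii), chosen ONCE, such that for every modulus `D` with `log D ≥ 43 250` and every primitive quadratic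
`χ ≠ χ₀` mod `D` the ONE world `worldJoint D χ` satisfies `Menu`, `PrimeMenu`, `MenuInformal`, `MenuInformalCritLine`,
`MenuInformalLOne`, `MenuCensus`, `MenuCensusRow18` AND `MenuLOneUpper` — every kernel-typed row that reads on an (A)-world.
A COMPANION outside the word's scope. [cite: Zhang2022LandauSiegel, §2 Assumption (A)] -/
def MenuJointConsistent : Prop :=
  ∃ C₇ : ℝ, 0 < C₇ ∧ ∃ c₀ : ℝ → ℝ, (∀ ε : ℝ, 0 < ε → 0 < c₀ ε) ∧
    ∃ C₂₈ : ℝ → ℝ, (∀ ε : ℝ, 0 < ε → 0 < C₂₈ ε) ∧ ∃ C₁₂ : ℝ → ℝ, ∃ R₀ : ℝ, 1 ≤ R₀ ∧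
  ∃ Q₀ Q₁ : (ℝ → ℝ) → ℝ → ℝ, ∃ T₀ : (ℝ → ℝ) → ℝ,
  ∃ C : ℝ, ∃ q₀ : ℝ → ℕ,
  ∃ c₁₆ : ℝ → ℕ, ∃ D₃ D₃' : ℝ → ℕ, ∃ C₅ : ℝ, ∃ D₅ : ℕ, ∃ Q₉ : (ℝ → ℝ) → ℝ → ℝ, (∀ ν ε, 1 ≤ Q₉ ν ε) ∧
  ∃ C₄ : ℝ, ∃ D₄ : ℕ,
    ∀ (D : ℕ) [NeZero D] (χ : DirichletCharacter ℂ D), χ.IsPrimitive → χ.IsQuadratic → χ ≠ 1 →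
      (43250 : ℝ) ≤ Real.log D →
        (worldJoint D χ).Menu D χ ∧ PrimeMenu (worldJoint D χ) (primeWorld D χ) ∧
          (worldJoint D χ).MenuInformal C₇ c₀ C₂₈ C₁₂ R₀ ∧ (worldJoint D χ).MenuInformalCritLine Q₀ Q₁ T₀ ∧
            (worldJoint D χ).MenuInformalLOne C q₀ ∧
              (worldJoint D χ).MenuCensus c₁₆ D₃ D₃' C₅ D₅ Q₉ ∧ (worldJoint D χ).MenuCensusRow18 C₄ D₄ ∧
                (worldJoint D χ).MenuLOneUpper

section JointData

variable {D : ℕ} {χ : DirichletCharacter ℂ D}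

/-- The value field of `W⁺′`. [cite: Zhang2022LandauSiegel, §2 Assumption (A)] -/
theorem worldJoint_LOne (q : ℕ) (ψ : DirichletCharacter ℂ q) :
    (worldJoint D χ).LOne q ψ =
      if IsExcSlot D χ q ψ then lam D
      else if ψ ≠ 1 ∧ jointLevel ≤ Real.log q then valueProfile q else 1 / 2 := rfl

/-- Same multiplicities as `W`. [cite: Zhang2022LandauSiegel, §2 Assumption (A)] -/
theorem worldJoint_mult : (worldJoint D χ).mult = (world D χ).mult := rfl

/-- Same zeros as `W`. [cite: Zhang2022LandauSiegel, §2 Assumption (A)] -/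
theorem isZero_worldJoint_iff {q : ℕ} {ψ : DirichletCharacter ℂ q} {ρ : ℂ} :
    (worldJoint D χ).IsZero q ψ ρ ↔ (world D χ).IsZero q ψ ρ := Iff.rfl

end JointData

/-! ## 12. The profile on the levels `log q ≥ 128`: `v₀(q) ≤ (log q)/6` -/

section JointNumerics

/-- `e^γ < 2` (`γ < 2/3 < log 2`). [folklore] -/
private theorem exp_gamma_lt_two : Real.exp Real.eulerMascheroniConstant < 2 := by
  have h23 : Real.eulerMascheroniConstant < 2 / 3 := Real.eulerMascheroniConstant_lt_two_thirds
  calc Real.exp Real.eulerMascheroniConstant < Real.exp (Real.log 2) :=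
        Real.exp_lt_exp.mpr (by linarith [two_thirds_lt_log_two])
    _ = 2 := Real.exp_log (by norm_num)

/-- `24 log x ≤ x` for `x ≥ 128` (`log x ≤ log 128 + x/128 − 1`, `log 128 = 7 log 2 < 4.8521`). [folklore] -/
private theorem twentyfour_mul_log_le {x : ℝ} (hx : 128 ≤ x) : 24 * Real.log x ≤ x := by
  have hx0 : 0 < x := by linarith
  have h128 : Real.log 128 = 7 * Real.log 2 := by
    rw [show (128 : ℝ) = 2 ^ 7 by norm_num, Real.log_pow]; norm_num
  have hsplit : Real.log x = Real.log 128 + Real.log (x / 128) := by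
    rw [← Real.log_mul (by norm_num) (by positivity)]; congr 1; ring
  have hconc : Real.log (x / 128) ≤ x / 128 - 1 := Real.log_le_sub_one_of_pos (by positivity)
  have hl2 := Real.log_two_lt_d9
  rw [hsplit, h128]
  nlinarith

variable {q : ℕ} (hq : jointLevel ≤ Real.log q)
include hq

/-- `log q ≥ 24` on the joint levels. [folklore] -/
private theorem h24_of_joint : (24 : ℝ) ≤ Real.log q := le_trans (by norm_num [jointLevel]) hq

/-- **`v₀(q) ≤ (log q)/6` for `log q ≥ 128`**: `e^γ < 2`, `log log x ≤ log x − 1`, `24 log x ≤ x`.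
[cite: GranvilleSoundararajan2006ExtremeValues, §7 Theorem 3 (ii) p.6] -/
theorem valueProfile_le_log_div_six : valueProfile q ≤ Real.log q / 6 := by
  unfold valueProfile
  have hx : (128 : ℝ) ≤ Real.log q := by simpa [jointLevel] using hq
  set x := Real.log (q : ℝ) with hxdef
  have hlx1 : 1 ≤ Real.log x := one_le_log_of_three_le (by linarith)
  have hlx0 : 0 < Real.log x := by linarith
  have hll : Real.log (Real.log x) ≤ Real.log x - 1 := Real.log_le_sub_one_of_pos hlx0
  have hll0 : 0 ≤ Real.log (Real.log x) := Real.log_nonneg hlx1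
  have hsum0 : 0 ≤ Real.log x + Real.log (Real.log x) := by linarith
  have hγ := exp_gamma_lt_two
  have hγ0 : 0 < Real.exp Real.eulerMascheroniConstant := Real.exp_pos _
  have h24 := twentyfour_mul_log_le hx
  calc Real.exp Real.eulerMascheroniConstant * (Real.log x + Real.log (Real.log x))
      ≤ 2 * (Real.log x + Real.log (Real.log x)) := by nlinarith
    _ ≤ 4 * Real.log x - 2 := by linarith
    _ ≤ x / 6 := by linarith

end JointNumerics

/-! ## 13. The value field of `W⁺′`: `0 < LOne ≤ max(½, (log q)/6)`; value rows, caps, dhE-18 (ii), census -/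

section JointRows

variable {D : ℕ} {χ : DirichletCharacter ℂ D}

variable (hL : (43250 : ℝ) ≤ Real.log D)
include hL

/-- **Every slot of `W⁺′` has value `≤ max(½, (log q)/6)`.** [cite: Zhang2022LandauSiegel, §2 Assumption (A)] -/
theorem worldJoint_LOne_le (q : ℕ) (ψ : DirichletCharacter ℂ q) :
    (worldJoint D χ).LOne q ψ ≤ max (1 / 2) (Real.log q / 6) := by
  rw [worldJoint_LOne]
  split_ifs with hs hp
  · exact le_trans (lam_le_half (by linarith)) (le_max_left _ _)
  · exact le_trans (valueProfile_le_log_div_six hp.2) (le_max_right _ _)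
  · exact le_max_left _ _

/-- Every slot of `W⁺′` has positive value. [cite: Zhang2022LandauSiegel, §2 Assumption (A)] -/
theorem worldJoint_LOne_pos (q : ℕ) (ψ : DirichletCharacter ℂ q) : 0 < (worldJoint D χ).LOne q ψ := by
  rw [worldJoint_LOne]
  split_ifs with hs hp
  · exact lam_pos_of_hL hL
  · exact valueProfile_pos (le_trans (by norm_num [jointLevel]) hp.2)
  · norm_num

omit hL in
/-- For `log q ≥ 1`: `max(½, (log q)/6) ≤ log q`. [folklore] -/
private theorem max_half_sixth_le {x : ℝ} (hx : 1 ≤ x) : max (1 / 2) (x / 6) ≤ x :=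
  max_le (by linarith) (by linarith)

/-- **(A) on `W⁺′`.** [cite: Zhang2022LandauSiegel, §2 Assumption (A)] -/
theorem worldJoint_assumptionA : (worldJoint D χ).LOne D χ < 1 / Real.log D ^ 2022 := by
  rw [worldJoint_LOne, if_pos isExcSlot_self]
  exact lam_lt_cap (log_pos_of_hL hL)

/-- **Row dhE-09 on `W⁺′`** (induced slots, value `λ`, as on `W`). [cite: BenliGoelTwissZaman2025, Lemma 2.9] -/
theorem worldJoint_row09 : ∀ (q : ℕ) [NeZero q], 400000 < q → ∀ χ₁ : DirichletCharacter ℂ q, χ₁.IsQuadratic →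
    χ₁ ≠ 1 → ∀ β₁ : ℝ, 1 - 1 / (10 * Real.log q) < β₁ → β₁ < 1 → (worldJoint D χ).IsZero q χ₁ β₁ →
      0.72 * (1 - β₁) ≤ (worldJoint D χ).LOne q χ₁ ∧
        (worldJoint D χ).LOne q χ₁ ≤ 0.18 * Real.log q ^ 2 * (1 - β₁) := by
  intro q _ hq χ₁ hquad hne β₁ hlo hhi hz
  have hz' : (world D χ).IsZero q χ₁ β₁ := hz
  obtain ⟨hs, rfl⟩ := real_zero_gt_half hL hz' (half_lt_of_window (by omega) hlo)
  have h := world_row09 (χ := χ) hL q hq χ₁ hquad hne (betaExc D) hlo hhi hz'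
  rw [world_LOne, if_pos hs] at h
  rw [worldJoint_LOne, if_pos hs]
  exact h

/-- **Row dhE-11 on `W⁺′`**: `LOne ≤ max(½, (log q)/6) ≤ log q` (`log q ≥ 1`). [cite: MontgomeryVaughan2007, §4.3] -/
theorem worldJoint_row11 : ∀ (q : ℕ) [NeZero q] (ψ : DirichletCharacter ℂ q), ψ ≠ 1 →
    (worldJoint D χ).LOne q ψ ≤ Real.log q := by
  intro q _ ψ hne
  exact le_trans (worldJoint_LOne_le hL q ψ) (max_half_sixth_le (one_le_log_of_ne_one hne))

/-- **Row dhE-12 on `W⁺′`** (as on `W`). [cite: Zhang2022LandauSiegel, Lemma 5.5] [cite: BenliGoelTwissZaman2025, Lemma 2.9] -/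
theorem worldJoint_row12 (hquad : χ.IsQuadratic) :
    (worldJoint D χ).LOne D χ < 1 / Real.log D ^ 2022 → 400000 < D →
    ∃ β₁ : ℝ, 1 - 1 / (10 * Real.log D) < β₁ ∧ β₁ < 1 ∧ (worldJoint D χ).mult D χ β₁ = 1 ∧ χ ^ 2 = 1 ∧
      (∀ (ψ : DirichletCharacter ℂ D) (β : ℝ), 1 - 1 / (10 * Real.log D) < β → β < 1 →
          (worldJoint D χ).IsZero D ψ β → ψ = χ ∧ β = β₁) ∧
      0.72 * (1 - β₁) ≤ (worldJoint D χ).LOne D χ ∧ 1 - β₁ < 25 / 18 / Real.log D ^ 2022 := by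
  intro _ hD
  have hA : (world D χ).LOne D χ < 1 / Real.log D ^ 2022 := by
    rw [world_LOne, if_pos isExcSlot_self]; exact lam_lt_cap (log_pos_of_hL hL)
  obtain ⟨β₁, h1, h2, h3, h4, h5, h6, h7⟩ := world_row12 hL hquad hA hD
  refine ⟨β₁, h1, h2, h3, h4, fun ψ β hlo hhi hz => h5 ψ β hlo hhi hz, ?_, h7⟩
  rw [world_LOne, if_pos isExcSlot_self] at h6
  rw [worldJoint_LOne, if_pos isExcSlot_self]
  exact h6

/-- **Row dhE-15 on `W⁺′`**: induced slots as on `W`; `v₀ ≥ 1 ≥ 0.69/√q`; `½ ≥ 0.69/√3`. [cite: MontgomeryVaughan2007, §4.3] -/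
theorem worldJoint_row15 : ∀ (q : ℕ) [NeZero q], 3 ≤ q → ∀ ψ : DirichletCharacter ℂ q, ψ.IsPrimitive →
    ψ.IsQuadratic → (69 / 100) / Real.sqrt q ≤ (worldJoint D χ).LOne q ψ := by
  intro q _ hq ψ hprim hquad
  have h1 : (69 / 100) / Real.sqrt q ≤ (world D χ).LOne q ψ := world_row15 hL q hq ψ hprim hquad
  rw [world_LOne] at h1
  rw [worldJoint_LOne]
  by_cases hs : IsExcSlot D χ q ψ
  · rw [if_pos hs] at h1 ⊢; exact h1
  · rw [if_neg hs] at h1 ⊢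
    have hq3 : (3 : ℝ) ≤ q := by exact_mod_cast hq
    by_cases hp : ψ ≠ 1 ∧ jointLevel ≤ Real.log q
    · rw [if_pos hp]
      exact le_trans (floor069_le_half hq3)
        (le_trans (by norm_num) (one_le_valueProfile (le_trans (by norm_num [jointLevel]) hp.2)))
    · rw [if_neg hp]; exact floor069_le_half hq3

/-- **Row dhE-19 on `W⁺′`: INERT** (same zeros as `W`). [cite: LamzouriLiSoundararajan2015, Theorem 1.5 p. 2393] -/
theorem worldJoint_row19 :
    (∀ (q : ℕ) (ψ : DirichletCharacter ℂ q) (ρ : ℂ), (worldJoint D χ).IsZero q ψ ρ → ρ.re = 1 / 2) →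
    ∀ (q : ℕ) [NeZero q] (ψ : DirichletCharacter ℂ q), ψ.IsPrimitive → (10 : ℝ) ^ 10 ≤ (q : ℝ) →
      (worldJoint D χ).LOne q ψ ≤
          2 * Real.exp Real.eulerMascheroniConstant * LamzouriLiSoundararajan2015.upperBracket q ∧
        1 / (worldJoint D χ).LOne q ψ ≤
          12 * Real.exp Real.eulerMascheroniConstant / Real.pi ^ 2 * LamzouriLiSoundararajan2015.lowerBracket q := by
  intro hGRH
  exfalso
  have hz : (worldJoint D χ).IsZero D χ ((betaExc D : ℝ) : ℂ) := by
    show 0 < (world D χ).mult D χ ((betaExc D : ℝ) : ℂ)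
    rw [mult_self_betaExc hL]; exact Nat.one_pos
  have h := hGRH D χ _ hz
  rw [Complex.ofReal_re] at h
  linarith [half_lt_betaExc hL]

/-- **Row S3 on `W⁺′`**: `LOne > 0`; `LOne(ψ̄) = LOne(ψ)` (induced slots and the profile predicate are stable under
`ψ ↦ ψ⁻¹`); `Lhalf ≥ 0`. [cite: MontgomeryVaughan2007, §4.3] -/
theorem worldJoint_rowS3 (hquad : χ.IsQuadratic) : ∀ (q : ℕ) [NeZero q] (ψ : DirichletCharacter ℂ q),
    (ψ ≠ 1 → 0 < (worldJoint D χ).LOne q ψ) ∧ (worldJoint D χ).LOne q ψ⁻¹ = (worldJoint D χ).LOne q ψ ∧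
      ∀ t : ℝ, 0 ≤ (worldJoint D χ).Lhalf q ψ t := by
  intro q _ ψ
  refine ⟨fun _ => worldJoint_LOne_pos hL q ψ, ?_, fun t => ?_⟩
  · rw [worldJoint_LOne, worldJoint_LOne]
    have hinv1 : (ψ⁻¹ ≠ 1) ↔ (ψ ≠ 1) := not_congr inv_eq_one
    by_cases hs : IsExcSlot D χ q ψ
    · rw [if_pos hs, if_pos ((isExcSlot_inv_iff hquad).mpr hs)]
    · rw [if_neg hs, if_neg (fun h => hs ((isExcSlot_inv_iff hquad).mp h))]
      by_cases hp : ψ ≠ 1 ∧ jointLevel ≤ Real.log q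
      · rw [if_pos hp, if_pos ⟨hinv1.mpr hp.1, hp.2⟩]
      · have hp' : ¬ (ψ⁻¹ ≠ 1 ∧ jointLevel ≤ Real.log q) := fun h => hp ⟨hinv1.mp h.1, h.2⟩
        rw [if_neg hp, if_neg hp']
  · show (0 : ℝ) ≤ (world D χ).Lhalf q ψ t
    rw [world_Lhalf]; norm_num

/-- `Menu` on `W⁺′`: zero rows verbatim from `W`, value rows as above. [cite: Zhang2022LandauSiegel, §2 Assumption (A)] -/
theorem menu_worldJoint [NeZero D] (hquad : χ.IsQuadratic) (hM : (world D χ).Menu D χ) : (worldJoint D χ).Menu D χ where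
  assumptionA := worldJoint_assumptionA hL
  row01 := hM.row01
  row02 := hM.row02
  row03 := hM.row03
  row04 := hM.row04
  row05 := hM.row05
  row06 := hM.row06
  row08 := hM.row08
  row09 := worldJoint_row09 hL
  row10 := hM.row10
  row11 := worldJoint_row11 hL
  row12 := worldJoint_row12 hL hquad
  row13 := hM.row13
  row15 := worldJoint_row15 hL
  row19 := worldJoint_row19 hL
  rowS1 := hM.rowS1
  rowS2 := hM.rowS2
  rowS3 := worldJoint_rowS3 hL hquad
  rowS4 := hM.rowS4

omit hL in
/-- `PrimeMenu` on `W⁺′` verbatim from `W`. [cite: ThornerZaman2024PNTAP, Theorem 1 p.3] -/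
theorem primeMenu_worldJoint (hM : PrimeMenu (world D χ) (primeWorld D χ)) :
    PrimeMenu (worldJoint D χ) (primeWorld D χ) where
  rowP1 := hM.rowP1
  rowP2 := hM.rowP2
  rowP3 := hM.rowP3
  rowP4 := hM.rowP4
  rowP5 := hM.rowP5
  rowP6 := hM.rowP6
  rowS5 := hM.rowS5

omit hL in
/-- `MenuInformal` on `W⁺′` verbatim from `W`. [cite: ThornerZaman2024PNTAP, Theorem 7 p.4] -/
theorem menuInformal_worldJoint {C₇ : ℝ} {c₀ C₂₈ C₁₂ : ℝ → ℝ} {R₀ : ℝ}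
    (hM : (world D χ).MenuInformal C₇ c₀ C₂₈ C₁₂ R₀) : (worldJoint D χ).MenuInformal C₇ c₀ C₂₈ C₁₂ R₀ where
  row07 := hM.row07
  row28 := hM.row28
  rowCor12 := hM.rowCor12
  rowKadiri := hM.rowKadiri

omit hL in
/-- `MenuInformalCritLine` on `W⁺′` verbatim from `W`. [cite: ConreyIwaniecSoundararajan2011CriticalZeros, Theorem 1] -/
theorem menuInformalCritLine_worldJoint {Q₀ Q₁ : (ℝ → ℝ) → ℝ → ℝ} {T₀ : (ℝ → ℝ) → ℝ}
    (hM : (world D χ).MenuInformalCritLine Q₀ Q₁ T₀) : (worldJoint D χ).MenuInformalCritLine Q₀ Q₁ T₀ where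
  rowCIS1 := hM.rowCIS1
  rowSono := hM.rowSono
  rowWu := hM.rowWu

/-- **Ramaré 2001 Cor. 1 on `W⁺′`**: `LOne ≤ max(½, x/6) ≤ x/2` and `≤ x/2 + (5/2 − log 6)` (`x = log q ≥ 1`).
[cite: Ramare2001LOneApproximateFormulae, Corollary 1 p. 248] -/
theorem worldJoint_rowR01c1 : ∀ (q : ℕ) [NeZero q] (ψ : DirichletCharacter ℂ q), ψ.IsPrimitive → ψ ≠ 1 →
    (ψ.Even → (worldJoint D χ).LOne q ψ ≤ Real.log q / 2) ∧
      (ψ.Odd → (worldJoint D χ).LOne q ψ ≤ Real.log q / 2 + (5 / 2 - Real.log 6)) := by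
  intro q _ ψ _ hne
  have h1 := one_le_log_of_ne_one hne
  have h2 := worldJoint_LOne_le (χ := χ) hL q ψ
  have hl6 := log_six_lt_two
  refine ⟨fun _ => le_trans h2 (max_le (by linarith) (by linarith)),
    fun _ => le_trans h2 (max_le (by linarith) (by linarith))⟩

/-- **Ramaré 2001 Cor. 3 on `W⁺′`** (`2 ∣ q`, `q ≥ 2`; `log q ≥ 1` from `ψ ≠ χ₀`).
[cite: Ramare2001LOneApproximateFormulae, Corollary 3 p. 248] -/
theorem worldJoint_rowR01c3 : ∀ (q : ℕ) [NeZero q] (ψ : DirichletCharacter ℂ q), ψ.IsPrimitive → ψ ≠ 1 → Even q →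
    (ψ.Even → (worldJoint D χ).LOne q ψ ≤ Real.log q / 4 + Real.log 2 / 2) ∧
      (ψ.Odd → (worldJoint D χ).LOne q ψ ≤ Real.log q / 4 + (5 / 4 - Real.log 3 / 2)) := by
  intro q _ ψ _ hne _
  have h1 := one_le_log_of_ne_one hne
  have h2 := worldJoint_LOne_le (χ := χ) hL q ψ
  have hl2 := two_thirds_lt_log_two
  have hl3 := log_three_lt_three_halves
  refine ⟨fun _ => le_trans h2 (max_le (by linarith) (by linarith)),
    fun _ => le_trans h2 (max_le (by linarith) (by linarith))⟩

/-- **Ramaré 2004 Cor. 2 on `W⁺′`**: `‖1 − ψ(2)/2‖ · LOne ≤ (3/2) · max(½, x/6) ≤ ¼(x + κ)` (`x = log q ≥ 1`).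
[cite: Ramare2004LOneApproximateFormulaeII, Corollary 2 p. 143] -/
theorem worldJoint_rowR04c2 : ∀ (q : ℕ) [NeZero q] (ψ : DirichletCharacter ℂ q), ψ.IsPrimitive → ψ ≠ 1 → Odd q →
    (ψ.Even → ‖(1 - ψ 2 / 2 : ℂ)‖ * (worldJoint D χ).LOne q ψ ≤ (Real.log q + 4 * Real.log 2) / 4) ∧
      (ψ.Odd → ‖(1 - ψ 2 / 2 : ℂ)‖ * (worldJoint D χ).LOne q ψ ≤ (Real.log q + (5 - 2 * Real.log (3 / 2))) / 4) := by
  intro q _ ψ _ hne _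
  have h1 := one_le_log_of_ne_one hne
  have hM : (worldJoint D χ).LOne q ψ ≤ (Real.log q + 4 * Real.log 2) / 6 := by
    refine le_trans (worldJoint_LOne_le (χ := χ) hL q ψ) (max_le ?_ ?_)
    · linarith [two_thirds_lt_log_two]
    · linarith [two_thirds_lt_log_two]
  have h0 := (worldJoint_LOne_pos (χ := χ) hL q ψ).le
  have hn : ‖(1 - ψ 2 / 2 : ℂ)‖ ≤ 3 / 2 := norm_one_sub_half_le (DirichletCharacter.norm_le_one ψ 2)
  have hprod : ‖(1 - ψ 2 / 2 : ℂ)‖ * (worldJoint D χ).LOne q ψ ≤ 3 / 2 * ((Real.log q + 4 * Real.log 2) / 6) :=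
    mul_le_mul hn hM h0 (by norm_num)
  refine ⟨fun _ => by linarith, fun _ => ?_⟩
  have hl := log_three_halves_le_half
  have hl2 := Real.log_two_lt_d9
  linarith

/-- **JRT 2023 Thm 1 on `W⁺′`**: `LOne ≤ max(½, x/6) ≤ x/2` (`q ≥ 2·10²³ ≥ 3`). [cite: JohnstonRamareTrudgian2023, Theorem 1] -/
theorem worldJoint_rowJRT1 : ∀ (q : ℕ) [NeZero q] (ψ : DirichletCharacter ℂ q), ψ.IsQuadratic → ψ.IsPrimitive →
    ψ.Odd → (2 * 10 ^ 23 : ℝ) ≤ q → (worldJoint D χ).LOne q ψ ≤ Real.log q / 2 := by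
  intro q _ ψ _ _ _ hq
  have h1 : (1 : ℝ) ≤ Real.log q := one_le_log_of_three_le (by linarith)
  exact le_trans (worldJoint_LOne_le hL q ψ) (max_le (by linarith) (by linarith))

/-- **JRT 2023 Thm 2 on `W⁺′`**: `LOne ≤ max(½, x/6) ≤ (9/20) x` (`x ≥ 2`). [cite: JohnstonRamareTrudgian2023, Theorem 2] -/
theorem worldJoint_rowJRT2 : ∀ (q : ℕ) [NeZero q] (ψ : DirichletCharacter ℂ q), ψ.IsQuadratic → ψ.IsPrimitive →
    ψ ≠ 1 → (ψ.Even ∧ (2 * 10 ^ 49 : ℝ) ≤ q ∨ ψ.Odd ∧ (5 * 10 ^ 50 : ℝ) ≤ q) →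
      (worldJoint D χ).LOne q ψ ≤ 9 / 20 * Real.log q := by
  intro q _ ψ _ _ _ hq
  have hq8 : (8 : ℝ) ≤ q := by
    rcases hq with ⟨-, h⟩ | ⟨-, h⟩ <;> linarith
  have h1 : (2 : ℝ) ≤ Real.log q := two_le_log_of_eight_le hq8
  exact le_trans (worldJoint_LOne_le hL q ψ) (max_le (by linarith) (by linarith))

/-- **`MenuLOneUpper` on `W⁺′`.** [cite: Ramare2001LOneApproximateFormulae, Corollary 1 p. 248] -/
theorem menuLOneUpper_worldJoint : (worldJoint D χ).MenuLOneUpper where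
  rowR01c1 := worldJoint_rowR01c1 hL
  rowR01c3 := worldJoint_rowR01c3 hL
  rowR04c2 := worldJoint_rowR04c2 hL
  rowJRT1 := worldJoint_rowJRT1 hL
  rowJRT2 := worldJoint_rowJRT2 hL

omit hL in
/-- `q ≥ q₀(A)` gives `log q ≥ max A 128`. [cite: GranvilleSoundararajan2006ExtremeValues, §7 Theorem 3 (ii) p.6] -/
theorem max_le_log_of_jointThreshold_le {A : ℝ} {q : ℕ} (h : jointThreshold A ≤ q) :
    max A jointLevel ≤ Real.log q := by
  have h1 : Real.exp (max A jointLevel) ≤ (q : ℝ) := le_trans (Nat.le_ceil _) (by exact_mod_cast h)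
  rw [Real.le_log_iff_exp_le (lt_of_lt_of_le (Real.exp_pos _) h1)]
  exact h1

omit hL in
/-- Counting on `W⁺′` (E-18d's `card_sub_two_le_largeValueCount`, `24 ↦ 128`): at a level with `log q ≥ 128` every
non-principal non-induced `ψ` has value `v₀(q)`, so for `V ≤ v₀(q)` the count is at least `#{ψ mod q} − 2`.
[cite: GranvilleSoundararajan2006ExtremeValues, §7 Theorem 3 (ii) p.6] -/
theorem card_sub_two_le_largeValueCount_joint {q : ℕ} [NeZero q] (hq : jointLevel ≤ Real.log q) {V : ℝ}
    (hV : V ≤ valueProfile q) :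
    Fintype.card (DirichletCharacter ℂ q) ≤ (worldJoint D χ).largeValueCount q V + 2 := by
  classical
  unfold ZeroWorld.largeValueCount
  set P : DirichletCharacter ℂ q → Prop := fun ψ => ψ ≠ 1 ∧ V ≤ (worldJoint D χ).LOne q ψ with hP
  set S := (Finset.univ.filter fun ψ : DirichletCharacter ℂ q => P ψ) with hS
  set E := (Finset.univ.filter fun ψ : DirichletCharacter ℂ q => IsExcSlot D χ q ψ) with hE
  have hcompl : (Finset.univ.filter fun ψ : DirichletCharacter ℂ q => ¬ P ψ) ⊆ {1} ∪ E := by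
    intro ψ hψ
    rw [Finset.mem_filter] at hψ
    rw [Finset.mem_union, Finset.mem_singleton, hE, Finset.mem_filter]
    by_cases h1 : ψ = 1
    · exact Or.inl h1
    by_cases h2 : IsExcSlot D χ q ψ
    · exact Or.inr ⟨Finset.mem_univ _, h2⟩
    exfalso
    apply hψ.2
    refine ⟨h1, ?_⟩
    show V ≤ (worldJoint D χ).LOne q ψ
    rw [worldJoint_LOne, if_neg h2, if_pos ⟨h1, hq⟩]
    exact hV
  have hsplit : (Finset.univ : Finset (DirichletCharacter ℂ q)).card =
      S.card + (Finset.univ.filter fun ψ : DirichletCharacter ℂ q => ¬ P ψ).card := by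
    rw [hS]; exact (Finset.card_filter_add_card_filter_not _).symm
  have hc2 : (Finset.univ.filter fun ψ : DirichletCharacter ℂ q => ¬ P ψ).card ≤ 2 := by
    calc (Finset.univ.filter fun ψ : DirichletCharacter ℂ q => ¬ P ψ).card ≤ (({1} : Finset _) ∪ E).card :=
          Finset.card_le_card hcompl
      _ ≤ ({1} : Finset (DirichletCharacter ℂ q)).card + E.card := Finset.card_union_le _ _
      _ ≤ 1 + 1 := Nat.add_le_add (by simp) (card_filter_isExcSlot_le_one q)
  rw [← Finset.card_univ, hsplit]
  omega

omit hL in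
/-- **Row dhE-18 (ii) on `W⁺′`** with `C = 0`, `q₀ = jointThreshold` (E-18d's `worldPlus_row18ii`, `24 ↦ 128`).
[cite: GranvilleSoundararajan2006ExtremeValues, §7 Theorem 3 (ii) p.6] -/
theorem worldJoint_row18ii : ∀ A : ℝ, 10 ≤ A → ∀ (q : ℕ) [NeZero q], q.Prime → jointThreshold A ≤ q →
    (q : ℝ) ^ (1 - 1 / A) ≤
      ((worldJoint D χ).largeValueCount q (GranvilleSoundararajan2006.largeValueLevel 0 A q) : ℝ) := by
  intro A hA q _ hprime hq
  have hmax := max_le_log_of_jointThreshold_le hq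
  have h128 : jointLevel ≤ Real.log q := le_trans (le_max_right _ _) hmax
  have h24 : (24 : ℝ) ≤ Real.log q := le_trans (by norm_num [jointLevel]) h128
  have hAq : A ≤ Real.log q := le_trans (le_max_left _ _) hmax
  have hcount := card_sub_two_le_largeValueCount_joint (D := D) (χ := χ) h128
    (largeValueLevel_le_valueProfile h24 (by linarith : (1 : ℝ) ≤ A))
  have hcard : Fintype.card (DirichletCharacter ℂ q) = q - 1 := by
    rw [← Nat.card_eq_fintype_card, DirichletCharacter.card_eq_totient_of_hasEnoughRootsOfUnity ℂ q,
      Nat.totient_prime hprime]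
  have hq2 : 2 ≤ q := hprime.two_le
  have hnat : q - 3 ≤ (worldJoint D χ).largeValueCount q (GranvilleSoundararajan2006.largeValueLevel 0 A q) := by
    rw [hcard] at hcount; omega
  have hreal : ((q : ℝ) - 3) ≤
      ((worldJoint D χ).largeValueCount q (GranvilleSoundararajan2006.largeValueLevel 0 A q) : ℝ) := by
    have h3q : 3 ≤ q := by
      by_contra hlt
      have hq2' : (q : ℝ) ≤ 2 := by exact_mod_cast (by omega : q ≤ 2)
      have : Real.log (q : ℝ) ≤ Real.log 2 := Real.log_le_log (by exact_mod_cast (by omega : 0 < q)) hq2'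
      linarith [Real.log_two_lt_d9]
    have := (Nat.cast_le (α := ℝ)).mpr hnat
    rw [Nat.cast_sub h3q] at this
    exact_mod_cast this
  exact le_trans (rpow_le_sub_three hA hAq h24) hreal

omit hL in
/-- On `W⁺′` the hypothesis `LOne ≤ 1/log² D'` with `D' ≥ 8` singles out an induced slot (`v₀ ≥ 1 > ¼`, `½ > ¼ ≥ 1/log² D'`),
where `W⁺′` and `W` carry the same value `λ(D)`. [cite: Pintz1976ElementaryII, Theorem 5 pp. 278–279 (1.30)–(1.31)] -/
theorem worldJoint_LOne_eq_world_of_le {D' : ℕ} (hD' : 8 ≤ D') {ψ : DirichletCharacter ℂ D'}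
    (hval : (worldJoint D χ).LOne D' ψ ≤ 1 / Real.log D' ^ 2) :
    (worldJoint D χ).LOne D' ψ = (world D χ).LOne D' ψ := by
  have h8 : (8 : ℝ) ≤ D' := by exact_mod_cast hD'
  have hlog : 2 ≤ Real.log (D' : ℝ) := two_le_log_of_eight_le h8
  have h4 : (4 : ℝ) ≤ Real.log (D' : ℝ) ^ 2 := by nlinarith
  have hquarter : 1 / Real.log (D' : ℝ) ^ 2 ≤ 1 / 4 := div_le_div_of_nonneg_left (by norm_num) (by norm_num) h4
  have hs : IsExcSlot D χ D' ψ := by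
    by_contra hns
    rw [worldJoint_LOne, if_neg hns] at hval
    by_cases hp : ψ ≠ 1 ∧ jointLevel ≤ Real.log D'
    · rw [if_pos hp] at hval
      have := one_le_valueProfile (le_trans (by norm_num [jointLevel]) hp.2)
      linarith
    · rw [if_neg hp] at hval
      linarith
  rw [worldJoint_LOne, world_LOne, if_pos hs, if_pos hs]

/-- **Census row 17 (Pintz Thm 5) on `W⁺′`** (`C := 1`, `D₀ := 8`), reduced to `W`.
[cite: Pintz1976ElementaryII, Theorem 5 pp. 278–279 (1.30)–(1.31)] -/
theorem worldJoint_rowPintz5 (hprim : χ.IsPrimitive) : ∀ (D' : ℕ) [NeZero D'], 8 ≤ D' →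
    ∀ ψ : DirichletCharacter ℂ D', ψ.IsQuadratic → ψ.IsPrimitive →
      (worldJoint D χ).LOne D' ψ ≤ 1 / Real.log D' ^ 2 →
        (∃ β : ℝ, 1 - 1 / Real.log D' ≤ β ∧ β < 1 ∧ (worldJoint D χ).IsZero D' ψ (β : ℂ)) ∧
        ∀ β : ℝ, (worldJoint D χ).isGreatestRealZero D' ψ β →
          (worldJoint D χ).LOne D' ψ / (1 - β) ≤
            1 * (Real.log D' * Real.log (Real.log D') /
                  Real.log (1 / (5 * (worldJoint D χ).LOne D' ψ * Real.log D'))) ^ 2 := by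
  intro D' _ hD' ψ hq hψ hval
  have hEq := worldJoint_LOne_eq_world_of_le (D := D) (χ := χ) hD' hval
  rw [hEq] at hval ⊢
  exact world_rowPintz5 hL hprim D' (by omega) ψ hq hψ hval

/-- **Census row 18 (Pintz Thm 4) on `W⁺′`** (`C₄ := 4e⁸·2021²`, `D₄ := 8`), reduced to `W`.
[cite: Pintz1976ElementaryII, Theorem 4 pp. 277–278 (1.25)–(1.26)] -/
theorem worldJoint_rowPintz4 (hprim : χ.IsPrimitive) : ∀ (D' : ℕ) [NeZero D'], 8 ≤ D' →
    ∀ ψ : DirichletCharacter ℂ D', ψ.IsQuadratic → ψ.IsPrimitive →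
      (worldJoint D χ).LOne D' ψ ≤ 1 / Real.log D' ^ 2 →
        Real.exp (∑ p ∈ (Finset.range (D' ^ 2 + 1)).filter Nat.Prime, (1 + (ψ (p : ZMod D')).re) / p) ≤
          (4 * Real.exp 8 * 2021 ^ 2) * (Real.log D' * Real.log (Real.log D') /
                Real.log (1 / (5 * (worldJoint D χ).LOne D' ψ * Real.log D'))) ^ 2 := by
  intro D' _ hD' ψ hq hψ hval
  have hEq := worldJoint_LOne_eq_world_of_le (D := D) (χ := χ) hD' hval
  rw [hEq] at hval ⊢
  exact world_rowPintz4 hL hprim D' (by omega) ψ hq hψ hval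

/-- **`MenuCensus` on `W⁺′`** (`c₁₆ := 0`, `D₃ = D₃' := 0`, `C₅ := 1`, `D₅ := 8`, `Q₉ := 1`). [cite: Zhang2022LandauSiegel, §2 Assumption (A)] -/
theorem menuCensus_worldJoint (hprim : χ.IsPrimitive) :
    (worldJoint D χ).MenuCensus (fun _ => 0) (fun _ => 0) (fun _ => 0) 1 8 (fun _ _ => 1) where
  rowRR1 := world_rowRR1 hL hprim
  rowKhale := world_rowKhale
  rowBP12 := world_rowBP12 hL hprim
  rowGS75 := world_rowGS75 hL hprim
  rowPintz3 := world_rowPintz3 hL hprim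
  rowPintz3S := world_rowPintz3S hL hprim
  rowPintz5 := worldJoint_rowPintz5 hL hprim

/-- **`MenuCensusRow18` on `W⁺′`** (`C₄ := 4e⁸·2021²`, `D₄ := 8`). [cite: Zhang2022LandauSiegel, §2 Assumption (A)] -/
theorem menuCensusRow18_worldJoint (hprim : χ.IsPrimitive) :
    (worldJoint D χ).MenuCensusRow18 (4 * Real.exp 8 * 2021 ^ 2) 8 where
  rowPintz4 := worldJoint_rowPintz4 hL hprim

end JointRows

/-- **THE JOINT COMPANION DISCHARGED: `MenuJointConsistent` holds** — ONE world, `W⁺′(D, χ)`, meets every kernel-typed row that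
reads on an (A)-world: `Menu`, `PrimeMenu` (p468827/p473947 transferred), `MenuInformal`, `MenuInformalCritLine` (p475376/p476879
transferred), dhE-18 (ii) `MenuInformalLOne` (`C := 0`, `q₀ := jointThreshold`), the census menus (`D₅ = D₄ := 8`) and the five
explicit `|L(1,χ)|` caps, for every `log D ≥ 43 250`. A COMPANION outside the word's scope. «The programme SEARCHES and TYPES;
no claim about Landau–Siegel zeros, Theorems 1–2 of arXiv:2211.02515 or a repaired Margin232 until a kernel theorem says so.»
[cite: Zhang2022LandauSiegel, §2 Assumption (A)] -/
theorem menuJointConsistent_holds : MenuJointConsistent := by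
  obtain ⟨C₇, hC₇, c₀, hc₀, C₂₈, hC₂₈, C₁₂, R₀, hR₀, hInf⟩ := menuInformalConsistent_holds
  obtain ⟨Q₀, Q₁, T₀, hCrit⟩ := menuInformalCritLineConsistent_holds
  refine ⟨C₇, hC₇, c₀, hc₀, C₂₈, hC₂₈, C₁₂, R₀, hR₀, Q₀, Q₁, T₀, 0, jointThreshold, fun _ => 0, fun _ => 0, fun _ => 0,
    1, 8, fun _ _ => 1, fun _ _ => le_rfl, 4 * Real.exp 8 * 2021 ^ 2, 8, ?_⟩
  intro D _ χ hprim hquad hne hL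
  exact ⟨menu_worldJoint hL hquad (menuConsistent_holds D χ hprim hquad hne hL),
    primeMenu_worldJoint (menuConsistentPrimes_holds D χ hprim hquad hne hL),
    menuInformal_worldJoint (hInf D χ hprim hquad hne hL),
    menuInformalCritLine_worldJoint (hCrit D χ hprim hquad hne hL),
    ⟨worldJoint_row18ii⟩,
    menuCensus_worldJoint hL hprim, menuCensusRow18_worldJoint hL hprim, menuLOneUpper_worldJoint hL⟩

/-- C2 probe for the joint companion. [cite: Zhang2022LandauSiegel, §2 Assumption (A)] -/
example : Literature.NumberTheory.LFunctions.Zhang2022.DH.MenuJointConsistent := menuJointConsistent_holds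

/-- The joint companion projects onto the minimal one's menus: `W⁺′` also witnesses `Menu ∧ PrimeMenu ∧ MenuLOneUpper`
(a corollary, for readers who cite the joint decl only). [cite: Zhang2022LandauSiegel, §2 Assumption (A)] -/
theorem menuJoint_core : ∀ (D : ℕ) [NeZero D] (χ : DirichletCharacter ℂ D), χ.IsPrimitive → χ.IsQuadratic → χ ≠ 1 →
    (43250 : ℝ) ≤ Real.log D →
      (worldJoint D χ).Menu D χ ∧ PrimeMenu (worldJoint D χ) (primeWorld D χ) ∧ (worldJoint D χ).MenuLOneUpper :=
  fun D _ χ hprim hquad hne hL =>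
    ⟨menu_worldJoint hL hquad (menuConsistent_holds D χ hprim hquad hne hL),
      primeMenu_worldJoint (menuConsistentPrimes_holds D χ hprim hquad hne hL), menuLOneUpper_worldJoint hL⟩

end Literature.NumberTheory.LFunctions.Zhang2022.DH

end
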